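import Literature.NumberTheory.LFunctions.RodgersTaoRenormHamiltonianDecayProofs
import HarnessLib

/-!
# Rodgers–Tao 2020, Lemma 20 (= arXiv v4 Lemma 7.5, «long-range decay of `H̃_{jk}`»): the
# RH-free CONTENT, Part II — the three clauses assembled, with `ε(j)` built from a modulus of (52)

LABEL (cell rh-crit, corpus C3 = Rodgers–Tao/Dobner, seat rt-t2; trunk T-ANT; LADDER-RH §1 COLUMN 3
DBN, bears_on N-C/N-P): **RH-FREE CONTENT.** Proofs only — NO definition, NO named fact. This leaf
assembles the regimes of `RodgersTaoRenormHamiltonianDecayProofs.lean` (Part I) into the content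
twin `rodgers_tao_renormHamiltonian_decay_of` of the printed Lemma 20
(`rodgers_tao_renormHamiltonian_decay` in `RodgersTaoHamiltonian.lean`, VACUOUS-AS-PRINTED on
`Λ/2 ≤ t ≤ 0` and discharged there EX FALSO): the SAME three clauses, verbatim, with the time
range `Λ/2 ≤ t ≤ 0` replaced by a compact interval `t ∈ [t₁, t₂]` strictly above a real-rooted
time `t₀`, and with the location law (50) and the gap law (52) on `[t₁, t₂]` as HYPOTHESES (schema
form, as in `RodgersTaoGapBoundProofs.lean` / `RodgersTaoMainAsymptoticsProofs.lean`); plus the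
as-printed REDUCTION `rodgers_tao_renormHamiltonian_decay_of_cor33 : cor33_location → cor33_gaps →
rodgers_tao_renormHamiltonian_decay` (an implication; no second `_holds`).

* §5 `exists_gap_modulus` (a modulus `η(n) → 0` for (52), uniform on blocks `[p, q]` with
  `n ≤ 2p`), thresholds (`log₊^n a ≤ c a`, `y ≤ log₊ n` eventually), `one_le_logPlus_classicalLocationZ`,
  `logPlus_classicalLocationZ_order` (Lemma 8 (i) over `ℤ*`).
* §6 the printed regimes as clauses with explicit constants: `renormHamiltonianZ_le_far_clause`
  (clause (1): `|k − j| ≥ 16B(κ/log 2+2)² log₊² j/c₂` and `≥ 16B log₊²(k−j)/c₂` ⇒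
  `H̃ ≤ 8B²(κ/log 2+2)⁴/c₂² · log₊⁴(|j|+|k|)/(k−j)²`), `renormHamiltonianZ_le_near_clause`
  (clause (3) from Proposition 13 + (70)), `renormHamiltonianZ_le_middle` /
  `renormHamiltonianZ_le_middle_clause` (clause (2): (52) iterated along `m ≤ 3ε⁻¹` blocks of
  length `⌊log₊² ξ_a⌋`, `H̃ ≤ ε² log₊⁴ ξ_j/(128 (k−j)²)` once `(48/c₂)(2η + (A₃+80π)/log₊ ξ_j) ≤ ε²/4`).
* §7 `rodgers_tao_renormHamiltonian_decay_of` (assembly: `ε(j) = min(ε₁, 2√Θ(|j|))`,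
  `Θ(n) = (48/c₃)(2η(n) + (A₃+80π)/log₊ ξ_n) → 0`; large `|j|` by §6, bounded index pairs by
  compactness `exists_renormHamiltonianZ_le_of_bounded`, `j < 0` by `x_{−j} = −x_j`) and
  `rodgers_tao_renormHamiltonian_decay_of_cor33`.

Source: B. Rodgers, T. Tao, *The de Bruijn–Newman constant is non-negative*, Forum Math. Pi 8
(2020) e6 (`RodgersTaoFMP2020`) = arXiv:1801.05914; VERSION/PAGES OPENED: v5 TeX
`rh-crit/rt/src/RodgersTao_arXiv1801.05914v5.tex` l.1139–1173 (Lemma 20 and its proof), l.1087–1137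
((70), (71), Lemma 19), l.610–623 (Corollary 10 (50)–(52)); FMP pp. 44–45, 23, 21.

DIVERGENCES (announced rt/STATUS 2026-08-26T11:54Z): all constants and thresholds explicit; the
printed «`ε(j)` going to zero sufficiently slowly» is realised as `min(ε₁, 2√Θ(|j|))` with `Θ`
built from a modulus of the hypothesis (52); the far field is used uniformly for
`|k − j| ≥ ε(j)⁻¹ log₊² ξ_j` (the printed proof splits at `|j|/2`); (45) enters in the corrected
form `lemma31_iii` (ERRATUM E7 of the §3 file); bounded index pairs (finitely many) are absorbed
into the constant by compactness, exactly as printed. Nothing in this file is worded as, or is,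
progress toward RH.

## References

* [RodgersTaoFMP2020] B. Rodgers, T. Tao, Forum Math. Pi 8 (2020) e6 = arXiv:1801.05914v4/v5:
  Lemma 20 p. 45 (= v4 Lemma 7.5) and its proof; (70)–(71) p. 44; Lemma 8 p. 21; Cor. 10 p. 23;
  Proposition 13 p. 31.

WHAT THIS IS NOT: not Lemma 20 at `t = 0`; no assertion of (50)/(52) at any `t ≥ Λ`; not progress
toward RH — nothing here bears on the truth of RH.
-/

noncomputable section

open Real Set Filter Topology

namespace Literature.NumberTheory.LFunctions

/-! ## §5 Tools for the assembly: a modulus for (52), thresholds, `log₊ ξ_j ≥ 1`, slowly varying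
comparisons -/

section Tools

/-- A uniform MODULUS for the gap law (52): from «for every `ε > 0` there is `j₀` …» one extracts
a single `η : ℕ → ℝ`, `0 < η ≤ 1`, `η → 0`, such that (52) holds at precision `η(n)` on every
block `[p, q]` with `n ≤ 2p`, once `n ≥ n₀` (this is the «`ε(j)` going to zero arbitrarily
slowly» bookkeeping of the printed proof). [cite: RodgersTaoFMP2020, Corollary 10 (52) p. 23 and Lemma 20 p. 45] -/
theorem exists_gap_modulus {S : Set ℝ}
    (h52 : ∀ ε : ℝ, 0 < ε → ∃ j₀ : ℕ, ∀ t ∈ S, ∀ j k : ℕ, j₀ ≤ j → j < k →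
      (k : ℝ) ≤ j + logPlus (classicalLocation (j : ℝ)) ^ 2 →
      |deBruijnZero t k - deBruijnZero t j -
          4 * π * ((k : ℝ) - j) / logPlus (classicalLocation (j : ℝ))| ≤
        ε * logPlus (classicalLocation (j : ℝ))) :
    ∃ η : ℕ → ℝ, (∀ n, 0 < η n) ∧ (∀ n, η n ≤ 1) ∧
      (∀ δ : ℝ, 0 < δ → ∃ N : ℕ, ∀ n : ℕ, N ≤ n → η n ≤ δ) ∧
      ∃ n₀ : ℕ, ∀ n : ℕ, n₀ ≤ n → ∀ t ∈ S, ∀ p q : ℕ, n ≤ 2 * p → p < q →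
        (q : ℝ) ≤ p + logPlus (classicalLocation (p : ℝ)) ^ 2 →
        |deBruijnZero t q - deBruijnZero t p -
            4 * π * ((q : ℝ) - p) / logPlus (classicalLocation (p : ℝ))| ≤
          η n * logPlus (classicalLocation (p : ℝ)) := by
  classical
  choose J₀ hJ₀ using fun m : ℕ ↦ h52 (1 / ((m : ℝ) + 1)) (by positivity)
  obtain ⟨N, hN⟩ : ∃ N : ℕ → ℕ, ∀ n, N n = Nat.findGreatest (fun m ↦ 2 * J₀ m ≤ n) n :=
    ⟨_, fun _ ↦ rfl⟩
  refine ⟨fun n ↦ 1 / ((N n : ℝ) + 1), fun n ↦ by positivity, fun n ↦ ?_, ?_, ⟨2 * J₀ 0, ?_⟩⟩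
  · rw [div_le_one (by positivity)]
    linarith [(N n).cast_nonneg (α := ℝ)]
  · intro δ hδ
    obtain ⟨M, hM⟩ := exists_nat_gt (1 / δ)
    refine ⟨max M (2 * J₀ M), fun n hn ↦ ?_⟩
    have hMn : M ≤ N n := by
      rw [hN]
      exact Nat.le_findGreatest ((le_max_left _ _).trans hn) ((le_max_right _ _).trans hn)
    have hMn' : (M : ℝ) ≤ N n := by exact_mod_cast hMn
    rw [div_le_iff₀ (by positivity)]
    rw [div_lt_iff₀ hδ] at hM
    nlinarith
  · intro n hn t ht p q hnp hpq hqp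
    have hspec : 2 * J₀ (N n) ≤ n := by
      rw [hN]
      exact Nat.findGreatest_spec (P := fun m ↦ 2 * J₀ m ≤ n) (Nat.zero_le n) hn
    exact hJ₀ (N n) t ht p q (by omega) hpq hqp

/-- Polylogarithms are eventually dominated: `log₊(a)^n ≤ c·a` for all naturals `a ≥ X`. [folklore] -/
private theorem exists_logPlus_pow_le_mul {c : ℝ} (hc : 0 < c) (n : ℕ) :
    ∃ X : ℕ, ∀ a : ℕ, X ≤ a → logPlus (a : ℝ) ^ n ≤ c * a := by
  have h := (Real.tendsto_pow_log_div_mul_add_atTop 1 (-2) n one_ne_zero).eventually_lt_const hc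
  obtain ⟨X₀, hX₀⟩ := Filter.eventually_atTop.1 h
  refine ⟨⌈X₀⌉₊ + 1, fun a ha ↦ ?_⟩
  have ha1 : (1 : ℝ) ≤ a := by exact_mod_cast (by omega : 1 ≤ a)
  have haX : X₀ ≤ 2 + (a : ℝ) := by
    have h1 := Nat.le_ceil X₀
    have h2 : ((⌈X₀⌉₊ : ℕ) : ℝ) ≤ a := by exact_mod_cast (by omega : ⌈X₀⌉₊ ≤ a)
    linarith
  have h3 := hX₀ (2 + a) haX
  rw [show (1 : ℝ) * (2 + a) + -2 = a by ring, div_lt_iff₀ (by linarith)] at h3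
  rw [logPlus_eq, abs_of_nonneg (by positivity)]
  exact h3.le

/-- `y ≤ log₊ n` for all naturals `n ≥ ⌈e^y⌉`. [folklore] -/
private theorem exists_le_logPlus (y : ℝ) : ∃ X : ℕ, ∀ n : ℕ, X ≤ n → y ≤ logPlus (n : ℝ) := by
  refine ⟨⌈Real.exp y⌉₊, fun n hn ↦ ?_⟩
  rw [logPlus_eq, abs_of_nonneg (Nat.cast_nonneg n), Real.le_log_iff_exp_le (by positivity)]
  have h1 := Nat.le_ceil (Real.exp y)
  have h2 : ((⌈Real.exp y⌉₊ : ℕ) : ℝ) ≤ n := by exact_mod_cast hn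
  linarith

/-- `1 ≤ log₊ ξ_y` for `y ≥ 1` (indeed `ξ_y > 4πe`). [cite: RodgersTaoFMP2020, Lemma 8 (i) p. 21] -/
theorem one_le_logPlus_classicalLocation {y : ℝ} (hy : 1 ≤ y) :
    1 ≤ logPlus (classicalLocation y) := by
  have h := RodgersTao2020.four_pi_mul_exp_one_lt_classicalLocation hy
  have hξ : 0 < classicalLocation y := classicalLocation_pos (by linarith)
  rw [logPlus_eq, abs_of_pos hξ, Real.le_log_iff_exp_le (by linarith)]
  have h1 : Real.exp 1 ≤ 4 * π * Real.exp 1 :=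
    le_mul_of_one_le_left (Real.exp_pos 1).le (by nlinarith [Real.pi_gt_three])
  linarith

/-- `1 ≤ log₊ ξ_j` for `j ∈ ℤ*`. [cite: RodgersTaoFMP2020, Lemma 8 (i) p. 21] -/
theorem one_le_logPlus_classicalLocationZ {j : ℤ} (hj : j ≠ 0) :
    1 ≤ logPlus (classicalLocationZ j) := by
  rcases lt_or_gt_of_ne hj with h | h
  · have h1 : (1 : ℝ) ≤ ((-j : ℤ) : ℝ) := by exact_mod_cast (by omega : (1 : ℤ) ≤ -j)
    rw [← logPlus_neg, ← classicalLocationZ_neg, classicalLocationZ_of_pos (by omega)]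
    exact one_le_logPlus_classicalLocation h1
  · have h1 : (1 : ℝ) ≤ (j : ℝ) := by exact_mod_cast h
    rw [classicalLocationZ_of_pos h]
    exact one_le_logPlus_classicalLocation h1

/-- `log₊(c x) ≤ log c + log₊ x` for `c ≥ 1`, `x ≥ 0`. [folklore] -/
private theorem logPlus_mul_le {c x : ℝ} (hc : 1 ≤ c) (hx : 0 ≤ x) :
    logPlus (c * x) ≤ Real.log c + logPlus x := by
  rw [logPlus_eq, logPlus_eq, abs_of_nonneg hx, abs_of_nonneg (by positivity),
    ← Real.log_mul (by positivity) (by positivity)]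
  exact Real.log_le_log (by positivity) (by nlinarith)

/-- `log₊ y ≤ 1 + y` for `y ≥ 0`. [folklore] -/
private theorem logPlus_le_add_one {y : ℝ} (hy : 0 ≤ y) : logPlus y ≤ 1 + y := by
  rw [logPlus_eq, abs_of_nonneg hy, Real.log_le_iff_le_exp (by positivity)]
  linarith [Real.add_one_le_exp (1 + y)]

/-- `((j.natAbs : ℕ) : ℝ) = |j|`. [folklore] -/
private theorem natAbs_cast_eq (j : ℤ) : ((j.natAbs : ℕ) : ℝ) = |(j : ℝ)| := by
  push_cast [Nat.cast_natAbs]; simp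

/-- Lemma 8 (i), the `log₊ ξ_j ≍ log₊ j` half, over `ℤ*`. [cite: RodgersTaoFMP2020, Lemma 8 (i) (43) p. 21] -/
theorem logPlus_classicalLocationZ_order {c C : ℝ}
    (h8 : ∀ y : ℝ, 1 ≤ y → c * logPlus y ≤ logPlus (classicalLocation y) ∧
      logPlus (classicalLocation y) ≤ C * logPlus y)
    {i : ℤ} (hi : i ≠ 0) :
    c * logPlus (i : ℝ) ≤ logPlus (classicalLocationZ i) ∧
      logPlus (classicalLocationZ i) ≤ C * logPlus (i : ℝ) := by
  rcases lt_or_gt_of_ne hi with h | h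
  · have h1 : (1 : ℝ) ≤ ((-i : ℤ) : ℝ) := by exact_mod_cast (by omega : (1 : ℤ) ≤ -i)
    rw [← logPlus_neg (classicalLocationZ i), ← classicalLocationZ_neg,
      classicalLocationZ_of_pos (by omega), ← logPlus_neg (i : ℝ), ← Int.cast_neg]
    exact h8 _ h1
  · have h1 : (1 : ℝ) ≤ (i : ℝ) := by exact_mod_cast h
    rw [classicalLocationZ_of_pos h]
    exact h8 _ h1

end Tools

/-! ## §6 The three regimes as clauses, with explicit constants -/

section Clauses

variable {t : ℝ}

/-- **Clause (1) of Lemma 20 (far field).** In the range `|k − j| ≥ 16B(κ/log 2 + 2)² log₊² j/c₂`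
and `|k − j| ≥ 16B log₊²(k − j)/c₂` (`κ = log(2 + B₀)`, `|ξ_i| ≤ B₀|i|`), the far-field bound
`renormHamiltonianZ_le_of_far` gives `H̃_{jk}(t) ≤ C log₊⁴(|j| + |k|)/(k − j)²` with
`C = 8B²(κ/log 2 + 2)⁴/c₂²` — the printed «`H̃_{jk}(t) ≪ log⁴₊(|j|+|k|)/|k−j|²`» in the regimes
`|k − j| ≥ |j|/2` and `ε(j)⁻¹ log₊² ξ_j ≤ |k − j| < |j|/2`.
[cite: RodgersTaoFMP2020, Lemma 20 (1) p. 45 (first two regimes of the proof)] -/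
theorem renormHamiltonianZ_le_far_clause {B c₂ B₀ : ℝ} (hB : 0 ≤ B)
    (h50 : ∀ j : ℤ, j ≠ 0 → |deBruijnZeroZ t j - classicalLocationZ j| ≤ B * logPlus (classicalLocationZ j))
    (hc₂ : 0 < c₂)
    (hii : ∀ j k : ℤ, j ≠ 0 → k ≠ 0 →
      c₂ * (|(k : ℝ) - j| / logPlus (|classicalLocationZ j| + |classicalLocationZ k|)) ≤
        |classicalLocationZ k - classicalLocationZ j|)
    (hB₀ : 0 < B₀) (hξB : ∀ i : ℤ, |classicalLocationZ i| ≤ B₀ * |(i : ℝ)|)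
    {j k : ℤ} (hj : j ≠ 0) (hk : k ≠ 0) (hjk : j ≠ k)
    (hfar1 : 16 * B * (Real.log (2 + B₀) / Real.log 2 + 2) ^ 2 / c₂ * logPlus (j : ℝ) ^ 2 ≤
      |(k : ℝ) - j|)
    (hfar2 : 16 * B * logPlus ((k : ℝ) - j) ^ 2 / c₂ ≤ |(k : ℝ) - j|) :
    renormHamiltonianZ t j k ≤
      8 * B ^ 2 * (Real.log (2 + B₀) / Real.log 2 + 2) ^ 4 / c₂ ^ 2 *
        (logPlus (|(j : ℝ)| + |(k : ℝ)|) ^ 4 / ((k : ℝ) - j) ^ 2) := by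
  set κ : ℝ := Real.log (2 + B₀) with hκ
  set Λ : ℝ := logPlus (|classicalLocationZ j| + |classicalLocationZ k|) with hΛ
  have hΛ0 : 0 < Λ := logPlus_pos _
  have hl2 : 0 < Real.log 2 := Real.log_pos one_lt_two
  have hκ0 : 0 ≤ κ := Real.log_nonneg (by linarith)
  have hLj : Real.log 2 ≤ logPlus (j : ℝ) := log_two_le_logPlus _
  have hΛle : Λ ≤ κ + logPlus (j : ℝ) + logPlus (k : ℝ) := logPlus_pair_le hB₀ hξB j k
  have hLk := logPlus_le_logPlus_add_logPlus_sub (j : ℝ) (k : ℝ)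
  have hκL : κ + 2 * logPlus (j : ℝ) ≤ (κ / Real.log 2 + 2) * logPlus (j : ℝ) := by
    have : κ ≤ κ / Real.log 2 * logPlus (j : ℝ) := by
      rw [div_mul_eq_mul_div, le_div_iff₀ hl2]; exact mul_le_mul_of_nonneg_left hLj hκ0
    linarith
  -- the far condition
  have hfar : 4 * B * Λ ^ 2 / c₂ ≤ |(k : ℝ) - j| := by
    have h1 : Λ ≤ (κ / Real.log 2 + 2) * logPlus (j : ℝ) + logPlus ((k : ℝ) - j) := by linarith
    have h2 : Λ ^ 2 ≤ 2 * ((κ / Real.log 2 + 2) * logPlus (j : ℝ)) ^ 2 +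
        2 * logPlus ((k : ℝ) - j) ^ 2 := by
      nlinarith [sq_nonneg ((κ / Real.log 2 + 2) * logPlus (j : ℝ) - logPlus ((k : ℝ) - j)), hΛ0]
    have h3 : 4 * B * Λ ^ 2 / c₂ ≤ 4 * B * (2 * ((κ / Real.log 2 + 2) * logPlus (j : ℝ)) ^ 2 +
        2 * logPlus ((k : ℝ) - j) ^ 2) / c₂ :=
      div_le_div_of_nonneg_right (mul_le_mul_of_nonneg_left h2 (by positivity)) hc₂.le
    have h4 : 4 * B * (2 * ((κ / Real.log 2 + 2) * logPlus (j : ℝ)) ^ 2 +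
        2 * logPlus ((k : ℝ) - j) ^ 2) / c₂ =
        (16 * B * (κ / Real.log 2 + 2) ^ 2 / c₂ * logPlus (j : ℝ) ^ 2 +
          16 * B * logPlus ((k : ℝ) - j) ^ 2 / c₂) / 2 := by ring
    linarith
  have hH := renormHamiltonianZ_le_of_far hB h50 hc₂ hii hj hk hjk hfar
  have hL2 := logPlus_add_logPlus_le (j : ℝ) (k : ℝ)
  have hLjk : Real.log 2 ≤ logPlus (|(j : ℝ)| + |(k : ℝ)|) := log_two_le_logPlus _
  have hΛb : Λ ≤ (κ / Real.log 2 + 2) * logPlus (|(j : ℝ)| + |(k : ℝ)|) := by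
    have : κ ≤ κ / Real.log 2 * logPlus (|(j : ℝ)| + |(k : ℝ)|) := by
      rw [div_mul_eq_mul_div, le_div_iff₀ hl2]; exact mul_le_mul_of_nonneg_left hLjk hκ0
    linarith
  have hΛ4 : Λ ^ 4 ≤ ((κ / Real.log 2 + 2) * logPlus (|(j : ℝ)| + |(k : ℝ)|)) ^ 4 :=
    pow_le_pow_left₀ hΛ0.le hΛb 4
  have hd0 : 0 < ((k : ℝ) - j) ^ 2 := by
    have : (k : ℝ) - j ≠ 0 := sub_ne_zero.2 (by exact_mod_cast hjk.symm)
    positivity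
  calc renormHamiltonianZ t j k ≤ 8 * B ^ 2 * Λ ^ 4 / (c₂ ^ 2 * ((k : ℝ) - j) ^ 2) := hH
    _ ≤ 8 * B ^ 2 * ((κ / Real.log 2 + 2) * logPlus (|(j : ℝ)| + |(k : ℝ)|)) ^ 4 /
          (c₂ ^ 2 * ((k : ℝ) - j) ^ 2) :=
        div_le_div_of_nonneg_right (mul_le_mul_of_nonneg_left hΛ4 (by positivity)) (by positivity)
    _ = _ := by rw [div_mul_div_comm]; ring

/-- **Clause (3) of Lemma 20 (near field).** For `|k − j| ≤ log₊² ξ_j`, with the Proposition-13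
bound `H_{jk}(t) ≤ A log₊² j log₊ log₊ j`, the near-field bound `renormHamiltonianZ_le_of_near`
and (70) give `H̃_{jk}(t) ≤ C log₊² j log₊ log₊ j` with
`C = (3 + |log C₂|)/log³2 + 2C₁/log²2 + 2BK²/(c₂ log 2) + A`, `K = (log(2+B₀) + 2 log C₁ + 2)/log 2 + 4`.
[cite: RodgersTaoFMP2020, Lemma 20 (3) p. 45 («follows from Proposition 13 and (70)»)] -/
theorem renormHamiltonianZ_le_near_clause {B c₂ C₂ B₀ C₁ A : ℝ}
    (hΛ : ∃ t₁ : ℝ, t₁ < t ∧ HasOnlyRealZeros (deBruijnH t₁)) (hB : 0 ≤ B)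
    (h50 : ∀ j : ℤ, j ≠ 0 → |deBruijnZeroZ t j - classicalLocationZ j| ≤ B * logPlus (classicalLocationZ j))
    (hc₂ : 0 < c₂)
    (hii : ∀ j k : ℤ, j ≠ 0 → k ≠ 0 →
      c₂ * (|(k : ℝ) - j| / logPlus (|classicalLocationZ j| + |classicalLocationZ k|)) ≤
        |classicalLocationZ k - classicalLocationZ j| ∧
      |classicalLocationZ k - classicalLocationZ j| ≤
        C₂ * (|(k : ℝ) - j| / logPlus (|classicalLocationZ j| + |classicalLocationZ k|)))
    (hB₀ : 0 < B₀) (hξB : ∀ i : ℤ, |classicalLocationZ i| ≤ B₀ * |(i : ℝ)|) (hC₁ : 1 ≤ C₁)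
    (h8 : ∀ i : ℤ, i ≠ 0 → logPlus (classicalLocationZ i) ≤ C₁ * logPlus (i : ℝ))
    (hA : 0 ≤ A) {j k : ℤ} (hj : j ≠ 0) (hk : k ≠ 0) (hjk : j ≠ k)
    (hP : hamiltonianInteraction t j k ≤ A * (logPlus (j : ℝ) ^ 2 * logPlus (logPlus (j : ℝ))))
    (hnear : |(k : ℝ) - j| ≤ logPlus (classicalLocationZ j) ^ 2) :
    renormHamiltonianZ t j k ≤
      ((3 + |Real.log C₂|) / Real.log 2 ^ 3 + 2 * C₁ / Real.log 2 ^ 2 +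
          2 * B * ((Real.log (2 + B₀) + 2 * Real.log C₁ + 2) / Real.log 2 + 4) ^ 2 /
            (c₂ * Real.log 2) + A) *
        (logPlus (j : ℝ) ^ 2 * logPlus (logPlus (j : ℝ))) := by
  set κ : ℝ := Real.log (2 + B₀) with hκ
  set K : ℝ := (κ + 2 * Real.log C₁ + 2) / Real.log 2 + 4 with hK
  set ℓ : ℝ := logPlus (classicalLocationZ j) with hℓ
  set Λ : ℝ := logPlus (|classicalLocationZ j| + |classicalLocationZ k|) with hΛdef
  set X : ℝ := logPlus (j : ℝ) with hX
  set Y : ℝ := logPlus (logPlus (j : ℝ)) with hY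
  have hl2 : 0 < Real.log 2 := Real.log_pos one_lt_two
  have hκ0 : 0 ≤ κ := Real.log_nonneg (by linarith)
  have hlC : 0 ≤ Real.log C₁ := Real.log_nonneg hC₁
  have hℓ1 : 1 ≤ ℓ := one_le_logPlus_classicalLocationZ hj
  have hXl : Real.log 2 ≤ X := log_two_le_logPlus _
  have hYl : Real.log 2 ≤ Y := log_two_le_logPlus _
  have hX0 : 0 < X := hl2.trans_le hXl
  have hY0 : 0 < Y := hl2.trans_le hYl
  have hℓX : ℓ ≤ C₁ * X := h8 j hj
  have hΛ0 : 0 < Λ := logPlus_pos _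
  have hΛℓ : ℓ ≤ Λ := logPlus_classicalLocationZ_le_pair j k
  obtain ⟨hii1, hii2⟩ := hii j k hj hk
  have hkj0 : 0 < |(k : ℝ) - j| := abs_pos.2 (sub_ne_zero.2 (by exact_mod_cast hjk.symm))
  have hC₂ : 0 < C₂ := by
    have hq : 0 < |(k : ℝ) - j| / Λ := by positivity
    have h1 : c₂ * (|(k : ℝ) - j| / Λ) ≤ C₂ * (|(k : ℝ) - j| / Λ) := hii1.trans hii2
    have h2 := le_of_mul_le_mul_right h1 hq
    linarith
  have hH := renormHamiltonianZ_le_of_near hΛ hB h50 hc₂ hii hj hk hjk (W := ℓ ^ 2)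
    (P := A * (X ^ 2 * Y)) (by nlinarith) hnear hP
  -- Λ ≤ K X
  have hLk := logPlus_le_logPlus_add_logPlus_sub (j : ℝ) (k : ℝ)
  have hLd : logPlus ((k : ℝ) - j) ≤ 2 * Real.log C₁ + 2 + 2 * X := by
    have h1 : logPlus ((k : ℝ) - j) ≤ logPlus (ℓ ^ 2) :=
      logPlus_mono (by rwa [abs_of_nonneg (sq_nonneg ℓ)])
    have h2 : logPlus (ℓ ^ 2) ≤ 2 * logPlus ℓ := by
      have h := Real.log_le_log (by positivity : (0 : ℝ) < 2 + ℓ ^ 2)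
        (show 2 + ℓ ^ 2 ≤ (2 + ℓ) ^ 2 by nlinarith)
      rw [Real.log_pow] at h
      rw [logPlus_eq, logPlus_eq, abs_of_nonneg (sq_nonneg ℓ), abs_of_nonneg (by linarith)]
      exact_mod_cast h
    have h3 : logPlus ℓ ≤ Real.log C₁ + Y := by
      have h3a : logPlus ℓ ≤ logPlus (C₁ * X) := logPlus_mono (by
        rw [abs_of_nonneg (by linarith), abs_of_nonneg (by positivity)]; exact hℓX)
      exact h3a.trans (logPlus_mul_le hC₁ hX0.le)
    have h4 : Y ≤ 1 + X := logPlus_le_add_one hX0.le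
    linarith
  have hΛK : Λ ≤ K * X := by
    have h1 : Λ ≤ κ + X + (X + (2 * Real.log C₁ + 2 + 2 * X)) := by
      linarith [logPlus_pair_le hB₀ hξB j k]
    have h2 : κ + 2 * Real.log C₁ + 2 ≤ (κ + 2 * Real.log C₁ + 2) / Real.log 2 * X := by
      rw [div_mul_eq_mul_div, le_div_iff₀ hl2]
      exact mul_le_mul_of_nonneg_left hXl (by positivity)
    have h3 : K * X = (κ + 2 * Real.log C₁ + 2) / Real.log 2 * X + 4 * X := by rw [hK]; ring
    linarith
  have hK0 : 0 ≤ K := by positivity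
  have hΛ2 : Λ ^ 2 ≤ K ^ 2 * X ^ 2 := by
    rw [← mul_pow]; exact pow_le_pow_left₀ hΛ0.le hΛK 2
  have hlogW : Real.log (C₂ * ℓ ^ 2) ≤ |Real.log C₂| + 2 * C₁ * X := by
    rw [Real.log_mul hC₂.ne' (by positivity), Real.log_pow]
    have : Real.log ℓ ≤ ℓ := (Real.log_le_sub_one_of_pos (by linarith)).trans (by linarith)
    push_cast
    linarith [le_abs_self (Real.log C₂)]
  have hlogΛ : -Real.log Λ ≤ 0 := by
    have := Real.log_nonneg (hℓ1.trans hΛℓ); linarith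
  have hmax : max 0 (Real.log (C₂ * ℓ ^ 2) - Real.log Λ + A * (X ^ 2 * Y)) ≤
      |Real.log C₂| + 2 * C₁ * X + A * (X ^ 2 * Y) :=
    max_le (by positivity) (by linarith)
  have h2B : 2 * B * Λ ^ 2 / c₂ ≤ 2 * B * K ^ 2 / c₂ * X ^ 2 := by
    rw [show 2 * B * K ^ 2 / c₂ * X ^ 2 = 2 * B * (K ^ 2 * X ^ 2) / c₂ by ring]
    exact div_le_div_of_nonneg_right (mul_le_mul_of_nonneg_left hΛ2 (by positivity)) hc₂.le
  -- coefficient conversions (`X, Y ≥ log 2`)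
  have hl22 : Real.log 2 ^ 2 ≤ X ^ 2 := pow_le_pow_left₀ hl2.le hXl 2
  have e1 : (1 : ℝ) ≤ X ^ 2 * Y / Real.log 2 ^ 3 := by
    rw [le_div_iff₀ (by positivity)]
    calc 1 * Real.log 2 ^ 3 = Real.log 2 ^ 2 * Real.log 2 := by ring
      _ ≤ X ^ 2 * Y := mul_le_mul hl22 hYl hl2.le (sq_nonneg X)
  have e2 : X ≤ X ^ 2 * Y / Real.log 2 ^ 2 := by
    rw [le_div_iff₀ (by positivity)]
    calc X * Real.log 2 ^ 2 = X * Real.log 2 * Real.log 2 := by ring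
      _ ≤ X * X * Y := mul_le_mul (mul_le_mul_of_nonneg_left hXl hX0.le) hYl hl2.le (by positivity)
      _ = X ^ 2 * Y := by ring
  have e3 : X ^ 2 ≤ X ^ 2 * Y / Real.log 2 := by
    rw [le_div_iff₀ hl2]; exact mul_le_mul_of_nonneg_left hYl (sq_nonneg X)
  have t1 := mul_le_mul_of_nonneg_left e1 (by positivity : (0 : ℝ) ≤ 3 + |Real.log C₂|)
  have t2 := mul_le_mul_of_nonneg_left e2 (by positivity : (0 : ℝ) ≤ 2 * C₁)
  have t3 := mul_le_mul_of_nonneg_left e3 (by positivity : (0 : ℝ) ≤ 2 * B * K ^ 2 / c₂)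
  calc renormHamiltonianZ t j k
      ≤ 1 + 2 * B * Λ ^ 2 / c₂ + max 0 (Real.log (C₂ * ℓ ^ 2) - Real.log Λ + A * (X ^ 2 * Y)) := hH
    _ ≤ (3 + |Real.log C₂|) * 1 + 2 * C₁ * X + 2 * B * K ^ 2 / c₂ * X ^ 2 + A * (X ^ 2 * Y) := by
        linarith
    _ ≤ (3 + |Real.log C₂|) * (X ^ 2 * Y / Real.log 2 ^ 3) + 2 * C₁ * (X ^ 2 * Y / Real.log 2 ^ 2) +
          2 * B * K ^ 2 / c₂ * (X ^ 2 * Y / Real.log 2) + A * (X ^ 2 * Y) := by linarith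
    _ = _ := by rw [hK]; ring

/-- `ℓ²/2 + 1 ≤ (ℓ − κ)²` when `ℓ ≥ 4κ + 4`, `κ ≥ 0`. [folklore] -/
private theorem sq_half_aux {ℓ κ : ℝ} (hκ : 0 ≤ κ) (hℓ : 4 * κ + 4 ≤ ℓ) :
    ℓ ^ 2 / 2 + 1 ≤ (ℓ - κ) ^ 2 := by
  nlinarith [mul_le_mul_of_nonneg_left hℓ (by linarith : (0 : ℝ) ≤ ℓ), sq_nonneg κ]

set_option maxHeartbeats 400000 in
/-- **Clause (2) of Lemma 20 (middle field), oriented form.** For naturals `1 ≤ a < b` at scale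
`j` (`a ≤ j ≤ 2a`, `j ≤ b ≤ 2j`) with `ε log₊² ξ_j ≤ b − a ≤ ε⁻¹ log₊² ξ_j`, iterating (52) at
precision `η` along `m ≤ 3ε⁻¹` blocks of length `W = ⌊log₊² ξ_a⌋ ≥ log₊² ξ_j/2`
(`renormHamiltonianZ_le_of_chain`) gives `H̃_{ab}(t) ≤ ε² log₊⁴ ξ_j/(128 (b − a)²)` as soon as
`(48/c₂)(2η + (A₃ + 80π)/log₊ ξ_j) ≤ ε²/4` — the printed «`(x_k − x_j)/(ξ_k − ξ_j) − 1 ≪ ε(j)` if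
`ε(j)` goes to zero slowly enough, and the claim then follows from (70)».
[cite: RodgersTaoFMP2020, Lemma 20 (2) p. 45 (third regime of the proof)] -/
theorem renormHamiltonianZ_le_middle {A₃ η c₂ c₁ C₁ ε : ℝ} {j a b : ℕ}
    (hη : 0 ≤ η) (hA : 0 ≤ A₃ + 80 * π)
    (h45 : ∀ p q : ℝ, 1 ≤ p → 1 ≤ q → p ≤ 2 * q → q ≤ 2 * p →
      |classicalLocation q - classicalLocation p -
          4 * π * (q - p) / Real.log (classicalLocation p / (4 * π))| ≤
        A₃ * ((q - p) ^ 2 / (p * Real.log (classicalLocation p) ^ 2)))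
    (h52 : ∀ p q : ℕ, j ≤ 2 * p → p < q → (q : ℝ) ≤ p + logPlus (classicalLocation (p : ℝ)) ^ 2 →
      |deBruijnZero t q - deBruijnZero t p -
          4 * π * ((q : ℝ) - p) / logPlus (classicalLocation (p : ℝ))| ≤
        η * logPlus (classicalLocation (p : ℝ)))
    (hc₂ : 0 < c₂)
    (hii : ∀ j k : ℤ, 1 ≤ j → j ≤ k →
      c₂ * (((k : ℝ) - j) / logPlus (classicalLocation (j : ℝ) + classicalLocation (k : ℝ))) ≤
        classicalLocation (k : ℝ) - classicalLocation (j : ℝ))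
    (hc₁ : 0 < c₁) (hcC : c₁ ≤ C₁)
    (h8 : ∀ y : ℝ, 1 ≤ y →
      c₁ * (y / logPlus y) ≤ classicalLocation y ∧ classicalLocation y ≤ C₁ * (y / logPlus y))
    (h4 : ∀ n : ℕ, j ≤ 2 * n → logPlus (classicalLocation (n : ℝ)) ^ 4 ≤ n)
    (hε0 : 0 < ε) (hε1 : ε ≤ 1)
    (hΘ : 48 / c₂ * (2 * η + (A₃ + 80 * π) / logPlus (classicalLocation (j : ℝ))) ≤ ε ^ 2 / 4)
    (hℓ : 4 * Real.log (2 * C₁ / c₁) + 4 ≤ logPlus (classicalLocation (j : ℝ)))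
    (ha1 : 1 ≤ a) (hab : a < b) (haj : a ≤ j) (hja : j ≤ 2 * a) (hjb : j ≤ b) (hbj : b ≤ 2 * j)
    (hd1 : ε * logPlus (classicalLocation (j : ℝ)) ^ 2 ≤ (b : ℝ) - a)
    (hd2 : (b : ℝ) - a ≤ ε⁻¹ * logPlus (classicalLocation (j : ℝ)) ^ 2) :
    renormHamiltonianZ t a b ≤
      ε ^ 2 * logPlus (classicalLocation (j : ℝ)) ^ 4 / (128 * ((b : ℝ) - a) ^ 2) := by
  set ℓ : ℝ := logPlus (classicalLocation (j : ℝ)) with hℓdef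
  set κ₁ : ℝ := Real.log (2 * C₁ / c₁) with hκ₁
  have hC₁ : 0 < C₁ := hc₁.trans_le hcC
  have hR1 : 1 ≤ 2 * C₁ / c₁ := by rw [le_div_iff₀ hc₁]; linarith
  have hκ₁0 : 0 ≤ κ₁ := Real.log_nonneg hR1
  have haR : (1 : ℝ) ≤ a := by exact_mod_cast ha1
  have hajR : (a : ℝ) ≤ j := by exact_mod_cast haj
  have hj1 : (1 : ℝ) ≤ j := haR.trans hajR
  have hjaR : (j : ℝ) ≤ 2 * a := by exact_mod_cast hja
  have hjbR : (j : ℝ) ≤ b := by exact_mod_cast hjb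
  have hbjR : (b : ℝ) ≤ 2 * j := by exact_mod_cast hbj
  have hb1 : (1 : ℝ) ≤ b := by linarith
  have habR : (a : ℝ) < b := by exact_mod_cast hab
  have hd0 : (0 : ℝ) < (b : ℝ) - a := by linarith
  have hℓ4 : 4 ≤ ℓ := by linarith
  have hκℓ : κ₁ ≤ ℓ := by linarith
  obtain ⟨h8a1, -⟩ := h8 a haR
  obtain ⟨h8j1, h8j2⟩ := h8 j hj1
  obtain ⟨-, h8b2⟩ := h8 b hb1
  have hLa : logPlus (a : ℝ) ≤ logPlus (j : ℝ) :=
    logPlus_mono (by rw [abs_of_nonneg (by linarith), abs_of_nonneg (by linarith)]; exact hajR)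
  have hLb : logPlus (j : ℝ) ≤ logPlus (b : ℝ) :=
    logPlus_mono (by rw [abs_of_nonneg (by linarith), abs_of_nonneg (by linarith)]; exact hjbR)
  have hLa0 : 0 < logPlus (a : ℝ) := logPlus_pos _
  have hLj0 : 0 < logPlus (j : ℝ) := logPlus_pos _
  have hLb0 : 0 < logPlus (b : ℝ) := logPlus_pos _
  have hξa0 : 0 < classicalLocation (a : ℝ) := classicalLocation_pos (by linarith)
  have hξj0 : 0 < classicalLocation (j : ℝ) := classicalLocation_pos (by linarith)
  have hξb0 : 0 < classicalLocation (b : ℝ) := classicalLocation_pos (by linarith)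
  -- ξ_a ≥ (c₁/(2C₁)) ξ_j and ξ_b ≤ (2C₁/c₁) ξ_j
  have hξa : c₁ / (2 * C₁) * classicalLocation (j : ℝ) ≤ classicalLocation (a : ℝ) := by
    have h1 : c₁ * ((j : ℝ) / 2 / logPlus (j : ℝ)) ≤ classicalLocation (a : ℝ) := by
      refine le_trans (mul_le_mul_of_nonneg_left ?_ hc₁.le) h8a1
      rw [div_le_div_iff₀ hLj0 hLa0]
      calc (j : ℝ) / 2 * logPlus (a : ℝ) ≤ (a : ℝ) * logPlus (a : ℝ) :=
            mul_le_mul_of_nonneg_right (by linarith) hLa0.le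
        _ ≤ (a : ℝ) * logPlus (j : ℝ) := mul_le_mul_of_nonneg_left hLa (by linarith)
    calc c₁ / (2 * C₁) * classicalLocation (j : ℝ)
        ≤ c₁ / (2 * C₁) * (C₁ * ((j : ℝ) / logPlus (j : ℝ))) :=
          mul_le_mul_of_nonneg_left h8j2 (by positivity)
      _ = c₁ * ((j : ℝ) / 2 / logPlus (j : ℝ)) := by field_simp
      _ ≤ _ := h1
  have hξb : classicalLocation (b : ℝ) ≤ 2 * C₁ / c₁ * classicalLocation (j : ℝ) := by
    have h1 : (b : ℝ) / logPlus (b : ℝ) ≤ 2 * (j : ℝ) / logPlus (j : ℝ) := by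
      rw [div_le_div_iff₀ hLb0 hLj0]
      calc (b : ℝ) * logPlus (j : ℝ) ≤ 2 * (j : ℝ) * logPlus (j : ℝ) :=
            mul_le_mul_of_nonneg_right hbjR hLj0.le
        _ ≤ 2 * (j : ℝ) * logPlus (b : ℝ) := mul_le_mul_of_nonneg_left hLb (by linarith)
    calc classicalLocation (b : ℝ) ≤ C₁ * ((b : ℝ) / logPlus (b : ℝ)) := h8b2
      _ ≤ C₁ * (2 * (j : ℝ) / logPlus (j : ℝ)) := mul_le_mul_of_nonneg_left h1 hC₁.le
      _ = 2 * C₁ / c₁ * (c₁ * ((j : ℝ) / logPlus (j : ℝ))) := by field_simp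
      _ ≤ 2 * C₁ / c₁ * classicalLocation (j : ℝ) := mul_le_mul_of_nonneg_left h8j1 (by positivity)
  have hr0 : 0 < c₁ / (2 * C₁) := by positivity
  have hLξa : ℓ - κ₁ ≤ logPlus (classicalLocation (a : ℝ)) := by
    rw [hℓdef, logPlus_eq, logPlus_eq, abs_of_pos hξa0, abs_of_pos hξj0]
    have hr1 : c₁ / (2 * C₁) ≤ 1 := by rw [div_le_one (by positivity)]; linarith
    have h1 : c₁ / (2 * C₁) * (2 + classicalLocation (j : ℝ)) ≤ 2 + classicalLocation (a : ℝ) := by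
      have e : c₁ / (2 * C₁) * (2 + classicalLocation (j : ℝ)) =
          2 * (c₁ / (2 * C₁)) + c₁ / (2 * C₁) * classicalLocation (j : ℝ) := by ring
      rw [e]; linarith
    have h2 := Real.log_le_log (by positivity) h1
    rw [Real.log_mul hr0.ne' (by positivity)] at h2
    have h3 : Real.log (c₁ / (2 * C₁)) = -κ₁ := by
      rw [hκ₁, ← Real.log_inv, inv_div]
    linarith
  have hLξb : logPlus (classicalLocation (b : ℝ)) ≤ ℓ + κ₁ := by
    rw [hℓdef, logPlus_eq, logPlus_eq, abs_of_pos hξb0, abs_of_pos hξj0]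
    have h1 : 2 + classicalLocation (b : ℝ) ≤ 2 * C₁ / c₁ * (2 + classicalLocation (j : ℝ)) := by
      have e : 2 * C₁ / c₁ * (2 + classicalLocation (j : ℝ)) =
          2 * (2 * C₁ / c₁) + 2 * C₁ / c₁ * classicalLocation (j : ℝ) := by ring
      rw [e]; linarith
    have h2 := Real.log_le_log (by positivity) h1
    rw [Real.log_mul (by positivity) (by positivity)] at h2
    linarith
  have hLξb2 : logPlus (classicalLocation (b : ℝ)) ≤ 2 * ℓ := by linarith
  have hΛ4 : logPlus (classicalLocation (a : ℝ) + classicalLocation (b : ℝ)) ≤ 4 * ℓ :=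
    (logPlus_classicalLocation_add_le haR habR.le).trans (by linarith)
  -- the block length W = ⌊log₊² ξ_a⌋
  set W : ℕ := ⌊logPlus (classicalLocation (a : ℝ)) ^ 2⌋₊ with hWdef
  have hW : (W : ℝ) ≤ logPlus (classicalLocation (a : ℝ)) ^ 2 := Nat.floor_le (sq_nonneg _)
  have hWl : logPlus (classicalLocation (a : ℝ)) ^ 2 < W + 1 := Nat.lt_floor_add_one _
  have hsq : ℓ ^ 2 / 2 + 1 ≤ logPlus (classicalLocation (a : ℝ)) ^ 2 := by
    have h1 : ℓ ^ 2 / 2 + 1 ≤ (ℓ - κ₁) ^ 2 := sq_half_aux hκ₁0 hℓ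
    have h2 : (ℓ - κ₁) ^ 2 ≤ logPlus (classicalLocation (a : ℝ)) ^ 2 :=
      pow_le_pow_left₀ (by linarith) hLξa 2
    linarith
  have hWℓ : ℓ ^ 2 / 2 ≤ W := by linarith
  have hW8 : (8 : ℝ) ≤ W := by
    have h16 : (4 : ℝ) * 4 ≤ ℓ * ℓ := mul_le_mul hℓ4 hℓ4 (by norm_num) (by linarith)
    have e3 : ℓ ^ 2 = ℓ * ℓ := by ring
    rw [e3] at hWℓ; linarith
  have hW1 : 1 ≤ W := by exact_mod_cast (show (1 : ℝ) ≤ W by linarith)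
  have hW0 : 0 < W := hW1
  have hWpos : (0 : ℝ) < W := by exact_mod_cast hW0
  have hWa : ((W : ℕ) : ℝ) ^ 2 ≤ a := by
    have h1 : (W : ℝ) ^ 2 ≤ (logPlus (classicalLocation (a : ℝ)) ^ 2) ^ 2 :=
      pow_le_pow_left₀ (Nat.cast_nonneg W) hW 2
    have h2 := h4 a hja
    have e : (logPlus (classicalLocation (a : ℝ)) ^ 2) ^ 2 = logPlus (classicalLocation (a : ℝ)) ^ 4 := by
      ring
    rw [e] at h1; linarith
  -- the number of blocks m = ⌊(b − a)/W⌋ + 1 ≤ 3 ε⁻¹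
  set m : ℕ := (b - a) / W + 1 with hmdef
  have hm : b - a ≤ m * W := by
    have := Nat.lt_div_mul_add (a := b - a) hW0
    rw [hmdef, add_mul, one_mul]; exact this.le
  have hε' : (1 : ℝ) ≤ ε⁻¹ := (one_le_inv₀ hε0).2 hε1
  have hmR : (m : ℝ) ≤ 3 * ε⁻¹ := by
    have h1 : (((b - a) / W : ℕ) : ℝ) ≤ ((b - a : ℕ) : ℝ) / W := Nat.cast_div_le
    have h2 : ((b - a : ℕ) : ℝ) = (b : ℝ) - a := by push_cast [Nat.cast_sub hab.le]; ring
    rw [h2] at h1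
    have h3 : ((b : ℝ) - a) / W ≤ 2 * ε⁻¹ := by
      rw [div_le_iff₀ hWpos]
      have : ε⁻¹ * ℓ ^ 2 ≤ 2 * ε⁻¹ * W := by
        have := mul_le_mul_of_nonneg_left hWℓ (by positivity : (0 : ℝ) ≤ 2 * ε⁻¹)
        linarith
      linarith
    have h5 : (m : ℝ) = (((b - a) / W : ℕ) : ℝ) + 1 := by rw [hmdef]; push_cast; ring
    rw [h5]; linarith
  -- the chain
  have h52' : ∀ p q : ℕ, (j + 1) / 2 ≤ p → p < q →
      (q : ℝ) ≤ p + logPlus (classicalLocation (p : ℝ)) ^ 2 →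
      |deBruijnZero t q - deBruijnZero t p -
          4 * π * ((q : ℝ) - p) / logPlus (classicalLocation (p : ℝ))| ≤
        η * logPlus (classicalLocation (p : ℝ)) :=
    fun p q hp hpq hqp ↦ h52 p q (by omega) hpq hqp
  have hU0 : 0 ≤ 2 * η * ℓ + (A₃ + 80 * π) :=
    add_nonneg (mul_nonneg (mul_nonneg (by norm_num) hη) (by linarith)) hA
  have hV0 : 0 ≤ η * logPlus (classicalLocation (b : ℝ)) + (A₃ + 80 * π) :=
    add_nonneg (mul_nonneg hη (logPlus_nonneg _)) hA
  have hsmallX : (m : ℝ) * (η * logPlus (classicalLocation (b : ℝ)) + (A₃ + 80 * π)) *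
      logPlus (classicalLocation (a : ℝ) + classicalLocation (b : ℝ)) / (c₂ * ((b : ℝ) - a)) ≤
      ε * ℓ ^ 2 / (16 * ((b : ℝ) - a)) := by
    have hU : η * logPlus (classicalLocation (b : ℝ)) + (A₃ + 80 * π) ≤
        2 * η * ℓ + (A₃ + 80 * π) := by
      have := mul_le_mul_of_nonneg_left hLξb2 hη; linarith
    have hnum : (m : ℝ) * (η * logPlus (classicalLocation (b : ℝ)) + (A₃ + 80 * π)) *
        logPlus (classicalLocation (a : ℝ) + classicalLocation (b : ℝ)) ≤
        3 * ε⁻¹ * (2 * η * ℓ + (A₃ + 80 * π)) * (4 * ℓ) := by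
      have h1 : (m : ℝ) * (η * logPlus (classicalLocation (b : ℝ)) + (A₃ + 80 * π)) ≤
          3 * ε⁻¹ * (2 * η * ℓ + (A₃ + 80 * π)) :=
        mul_le_mul hmR hU hV0 (by positivity)
      exact mul_le_mul h1 hΛ4 (logPlus_nonneg _) (mul_nonneg (by positivity) hU0)
    have h2 : (2 * η * ℓ + (A₃ + 80 * π)) * ℓ ≤ c₂ * ε ^ 2 * ℓ ^ 2 / 192 := by
      have h1 := mul_le_mul_of_nonneg_right hΘ (sq_nonneg ℓ)
      have e : 48 / c₂ * (2 * η + (A₃ + 80 * π) / ℓ) * ℓ ^ 2 =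
          48 / c₂ * ((2 * η * ℓ + (A₃ + 80 * π)) * ℓ) := by
        field_simp
      rw [e, div_mul_eq_mul_div, div_le_iff₀ hc₂] at h1
      linarith
    rw [div_le_div_iff₀ (by positivity) (by positivity)]
    have h3 : 3 * ε⁻¹ * (2 * η * ℓ + (A₃ + 80 * π)) * (4 * ℓ) * (16 * ((b : ℝ) - a)) ≤
        ε * ℓ ^ 2 * (c₂ * ((b : ℝ) - a)) := by
      have h3a : 3 * ε⁻¹ * (2 * η * ℓ + (A₃ + 80 * π)) * (4 * ℓ) * (16 * ((b : ℝ) - a)) =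
          192 * ε⁻¹ * ((b : ℝ) - a) * ((2 * η * ℓ + (A₃ + 80 * π)) * ℓ) := by ring
      have h3b : ε * ℓ ^ 2 * (c₂ * ((b : ℝ) - a)) =
          192 * ε⁻¹ * ((b : ℝ) - a) * (c₂ * ε ^ 2 * ℓ ^ 2 / 192) := by
        field_simp
      rw [h3a, h3b]
      exact mul_le_mul_of_nonneg_left h2 (by positivity)
    calc _ ≤ 3 * ε⁻¹ * (2 * η * ℓ + (A₃ + 80 * π)) * (4 * ℓ) * (16 * ((b : ℝ) - a)) :=
          mul_le_mul_of_nonneg_right hnum (by positivity)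
      _ ≤ _ := h3
  have hsmall16 : ε * ℓ ^ 2 / (16 * ((b : ℝ) - a)) ≤ 1 / 16 := by
    rw [div_le_div_iff₀ (by positivity) (by norm_num)]; linarith
  have hsmall : (m : ℝ) * (η * logPlus (classicalLocation (b : ℝ)) + (A₃ + 80 * π)) *
      logPlus (classicalLocation (a : ℝ) + classicalLocation (b : ℝ)) / (c₂ * ((b : ℝ) - a)) ≤
      1 / 2 := hsmallX.trans (hsmall16.trans (by norm_num))
  have hH := renormHamiltonianZ_le_of_chain hη h45 h52' hc₂ hii (by omega) ha1 hWa hW hW1 hab hm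
    hsmall
  have hX0 : 0 ≤ (m : ℝ) * (η * logPlus (classicalLocation (b : ℝ)) + (A₃ + 80 * π)) *
      logPlus (classicalLocation (a : ℝ) + classicalLocation (b : ℝ)) / (c₂ * ((b : ℝ) - a)) :=
    div_nonneg (mul_nonneg (mul_nonneg (Nat.cast_nonneg m) hV0) (logPlus_nonneg _)) (by positivity)
  calc renormHamiltonianZ t a b
      ≤ 2 * ((m : ℝ) * (η * logPlus (classicalLocation (b : ℝ)) + (A₃ + 80 * π)) *
          logPlus (classicalLocation (a : ℝ) + classicalLocation (b : ℝ)) / (c₂ * ((b : ℝ) - a))) ^ 2 := hH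
    _ ≤ 2 * (ε * ℓ ^ 2 / (16 * ((b : ℝ) - a))) ^ 2 :=
        mul_le_mul_of_nonneg_left (pow_le_pow_left₀ hX0 hsmallX 2) (by norm_num)
    _ = ε ^ 2 * ℓ ^ 4 / (128 * ((b : ℝ) - a) ^ 2) := by
        field_simp
        ring

/-- **Clause (2) of Lemma 20 (middle field)** for positive integer indices `j ≠ k` in the range
`ε log₊² ξ_j ≤ |k − j| ≤ ε⁻¹ log₊² ξ_j ≤ j/2`: `H̃_{jk}(t) ≤ ε² log₊⁴ ξ_j/(128 (k − j)²)`
(`renormHamiltonianZ_le_middle` in both orientations, `H̃_{jk} = H̃_{kj}`).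
[cite: RodgersTaoFMP2020, Lemma 20 (2) p. 45] -/
theorem renormHamiltonianZ_le_middle_clause {A₃ η c₂ c₁ C₁ ε : ℝ} {j k : ℕ}
    (hη : 0 ≤ η) (hA : 0 ≤ A₃ + 80 * π)
    (h45 : ∀ p q : ℝ, 1 ≤ p → 1 ≤ q → p ≤ 2 * q → q ≤ 2 * p →
      |classicalLocation q - classicalLocation p -
          4 * π * (q - p) / Real.log (classicalLocation p / (4 * π))| ≤
        A₃ * ((q - p) ^ 2 / (p * Real.log (classicalLocation p) ^ 2)))
    (h52 : ∀ p q : ℕ, j ≤ 2 * p → p < q → (q : ℝ) ≤ p + logPlus (classicalLocation (p : ℝ)) ^ 2 →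
      |deBruijnZero t q - deBruijnZero t p -
          4 * π * ((q : ℝ) - p) / logPlus (classicalLocation (p : ℝ))| ≤
        η * logPlus (classicalLocation (p : ℝ)))
    (hc₂ : 0 < c₂)
    (hii : ∀ j k : ℤ, 1 ≤ j → j ≤ k →
      c₂ * (((k : ℝ) - j) / logPlus (classicalLocation (j : ℝ) + classicalLocation (k : ℝ))) ≤
        classicalLocation (k : ℝ) - classicalLocation (j : ℝ))
    (hc₁ : 0 < c₁) (hcC : c₁ ≤ C₁)
    (h8 : ∀ y : ℝ, 1 ≤ y →
      c₁ * (y / logPlus y) ≤ classicalLocation y ∧ classicalLocation y ≤ C₁ * (y / logPlus y))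
    (h4 : ∀ n : ℕ, j ≤ 2 * n → logPlus (classicalLocation (n : ℝ)) ^ 4 ≤ n)
    (hε0 : 0 < ε) (hε1 : ε ≤ 1)
    (hΘ : 48 / c₂ * (2 * η + (A₃ + 80 * π) / logPlus (classicalLocation (j : ℝ))) ≤ ε ^ 2 / 4)
    (hℓ : 4 * Real.log (2 * C₁ / c₁) + 4 ≤ logPlus (classicalLocation (j : ℝ)))
    (hdj : ε⁻¹ * logPlus (classicalLocation (j : ℝ)) ^ 2 ≤ (j : ℝ) / 2)
    (hj : 1 ≤ j) (hk : 1 ≤ k) (hjk : j ≠ k)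
    (hd1 : ε * logPlus (classicalLocation (j : ℝ)) ^ 2 ≤ |(k : ℝ) - j|)
    (hd2 : |(k : ℝ) - j| ≤ ε⁻¹ * logPlus (classicalLocation (j : ℝ)) ^ 2) :
    renormHamiltonianZ t j k ≤
      ε ^ 2 * logPlus (classicalLocation (j : ℝ)) ^ 4 / (128 * ((k : ℝ) - j) ^ 2) := by
  rcases lt_or_gt_of_ne hjk with h | h
  · have hlt : (j : ℝ) < k := by exact_mod_cast h
    have hd : |(k : ℝ) - j| = (k : ℝ) - j := abs_of_pos (by linarith)
    rw [hd] at hd1 hd2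
    have hkj : k ≤ 2 * j := by exact_mod_cast (show (k : ℝ) ≤ 2 * j by linarith)
    exact renormHamiltonianZ_le_middle hη hA h45 h52 hc₂ hii hc₁ hcC h8 h4 hε0 hε1 hΘ hℓ hj h
      le_rfl (by omega) h.le hkj hd1 hd2
  · have hlt : (k : ℝ) < j := by exact_mod_cast h
    have hd : |(k : ℝ) - j| = (j : ℝ) - k := by
      rw [abs_sub_comm]; exact abs_of_pos (by linarith)
    rw [hd] at hd1 hd2
    have hja : j ≤ 2 * k := by exact_mod_cast (show (j : ℝ) ≤ 2 * k by linarith)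
    have := renormHamiltonianZ_le_middle hη hA h45 h52 hc₂ hii hc₁ hcC h8 h4 hε0 hε1 hΘ hℓ hk h
      h.le hja le_rfl (by omega) hd1 hd2
    rw [renormHamiltonianZ_comm, show ((k : ℕ) : ℝ) - j = -(((j : ℕ) : ℝ) - k) by ring, neg_sq]
    exact this

end Clauses



/-! ## §7 Assembly: Lemma 20 with `t ∈ [t₁, t₂]` in place of `Λ/2 ≤ t ≤ 0` -/

section Assembly

/-- `log₊ ξ_{|j|} = log₊ ξ^{ℤ}_j` for `j ∈ ℤ*`. [cite: RodgersTaoFMP2020, §3 (42) p. 21] -/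
private theorem logPlus_classicalLocation_natAbs {j : ℤ} (hj : j ≠ 0) :
    logPlus (classicalLocation (j.natAbs : ℝ)) = logPlus (classicalLocationZ j) := by
  rcases lt_or_gt_of_ne hj with h | h
  · rw [← logPlus_neg (classicalLocationZ j), ← classicalLocationZ_neg,
      classicalLocationZ_of_pos (by omega), natAbs_cast_eq, ← Int.cast_abs, abs_of_neg h]
  · rw [classicalLocationZ_of_pos h, natAbs_cast_eq, ← Int.cast_abs, abs_of_pos h]

/-- The quantity `Θ(n) = (48/c₃)(2η(n) + C_ξ/log₊ ξ_n)` driving `ε(j) = 2√Θ(|j|)` tends to `0`.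
[cite: RodgersTaoFMP2020, Lemma 20 p. 45 («`ε(j)` going to zero … arbitrarily slowly»)] -/
private theorem theta_eventually_le {η : ℕ → ℝ} {c₃ c₁ Cξ : ℝ} (hc₃ : 0 < c₃) (hc₁ : 0 < c₁)
    (hηlim : ∀ δ : ℝ, 0 < δ → ∃ N : ℕ, ∀ n : ℕ, N ≤ n → η n ≤ δ)
    (h8 : ∀ y : ℝ, 1 ≤ y → c₁ * logPlus y ≤ logPlus (classicalLocation y))
    {η₀ : ℝ} (hη₀ : 0 < η₀) :
    ∃ N : ℕ, ∀ n : ℕ, N ≤ n →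
      48 / c₃ * (2 * η n + Cξ / logPlus (classicalLocation (n : ℝ))) ≤ η₀ ^ 2 / 4 := by
  obtain ⟨N₁, hN₁⟩ := hηlim (c₃ * η₀ ^ 2 / 768) (by positivity)
  obtain ⟨N₂, hN₂⟩ := exists_le_logPlus (384 * Cξ / (c₃ * η₀ ^ 2) / c₁)
  refine ⟨N₁ + N₂ + 1, fun n hn ↦ ?_⟩
  have hn1 : (1 : ℝ) ≤ n := by exact_mod_cast (by omega : 1 ≤ n)
  have hη' := hN₁ n (by omega)
  have hL' := hN₂ n (by omega)
  have h8n := h8 (n : ℝ) hn1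
  have hℓ0 : 0 < logPlus (classicalLocation (n : ℝ)) := logPlus_pos _
  have hℓn : 384 * Cξ / (c₃ * η₀ ^ 2) ≤ logPlus (classicalLocation (n : ℝ)) := by
    rw [div_le_iff₀' hc₁] at hL'
    linarith
  have h1 : Cξ / logPlus (classicalLocation (n : ℝ)) ≤ c₃ * η₀ ^ 2 / 384 := by
    rw [div_le_iff₀ hℓ0]
    rw [div_le_iff₀ (by positivity)] at hℓn
    linarith
  calc 48 / c₃ * (2 * η n + Cξ / logPlus (classicalLocation (n : ℝ)))
      ≤ 48 / c₃ * (2 * (c₃ * η₀ ^ 2 / 768) + c₃ * η₀ ^ 2 / 384) :=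
        mul_le_mul_of_nonneg_left (by linarith) (by positivity)
    _ = η₀ ^ 2 / 4 := by
        field_simp
        ring

set_option maxHeartbeats 400000 in
/-- **Rodgers–Tao Lemma 20 (= arXiv v4 Lemma 7.5), RH-free content** («long-range decay of
`H̃_{jk}`»): at every time `t` of a compact interval `[t₁, t₂]` strictly above a real-rooted time
`t₀` (where the zeros `x_j(t)` are real, simple and ordered), IF the macroscopic location law (50)
holds on `[t₁, t₂]` with constant `B` and the gap law (52) holds uniformly on `[t₁, t₂]`
(«for every `ε > 0` there is `j₀`…»), THEN there are `ε : ℤ → (0, ∞)` tending to zero as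
`|j| → ∞` and `C` such that for `t ∈ [t₁, t₂]` and distinct `j, k ∈ ℤ*` the three printed bounds
hold: (1) `H̃_{jk}(t) ≤ C log₊⁴(|j|+|k|)/|k−j|²` when `|k − j| ≥ ε(j)⁻¹ log₊² ξ_j`;
(2) `H̃_{jk}(t) ≤ C ε(j)² log₊⁴ j/|j − k|²` when `ε(j) log₊² ξ_j ≤ |k − j| ≤ ε(j)⁻¹ log₊² ξ_j`;
(3) `H̃_{jk}(t) ≤ C log₊² j log₊ log₊ j` when `|k − j| < ε(j) log₊² ξ_j`. The clauses are those of
`rodgers_tao_renormHamiltonian_decay` verbatim with `Λ/2 ≤ t ≤ 0` replaced by `t ∈ Icc t₁ t₂`.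
Proof = the printed one: far field from (50) + (44) + (70) (`renormHamiltonianZ_le_far_clause`),
middle field by iterating (52) `O(ε(j)⁻¹)` times (`renormHamiltonianZ_le_middle_clause`), near
field from Proposition 13 (`rodgers_tao_gap_bound_of`) + (70) (`renormHamiltonianZ_le_near_clause`),
bounded indices by compactness (`exists_renormHamiltonianZ_le_of_bounded`), `j < 0` by the
symmetry `x_{−j} = −x_j`; `ε(j) = min(ε₁, 2√Θ(|j|))` with `Θ` built from a modulus of (52)
(`exists_gap_modulus`). [cite: RodgersTaoFMP2020, Lemma 20 p. 45 (= arXiv:1801.05914v4 Lemma 7.5) and its proof] -/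
theorem rodgers_tao_renormHamiltonian_decay_of {t₀ t₁ t₂ B : ℝ} (h01 : t₀ < t₁)
    (hreal : HasOnlyRealZeros (deBruijnH t₀))
    (h50 : ∀ t ∈ Icc t₁ t₂, ∀ n : ℕ, 1 ≤ n →
      |deBruijnZero t n - classicalLocation (n : ℝ)| ≤ B * logPlus (classicalLocation (n : ℝ)))
    (h52 : ∀ ε : ℝ, 0 < ε → ∃ j₀ : ℕ, ∀ t ∈ Icc t₁ t₂, ∀ j k : ℕ, j₀ ≤ j → j < k →
      (k : ℝ) ≤ j + logPlus (classicalLocation (j : ℝ)) ^ 2 →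
      |deBruijnZero t k - deBruijnZero t j -
          4 * π * ((k : ℝ) - j) / logPlus (classicalLocation (j : ℝ))| ≤
        ε * logPlus (classicalLocation (j : ℝ))) :
    ∃ ε : ℤ → ℝ, (∀ j, 0 < ε j) ∧
      (∀ η : ℝ, 0 < η → ∃ J : ℝ, ∀ j : ℤ, J ≤ |(j : ℝ)| → ε j ≤ η) ∧
      ∃ C : ℝ, ∀ t ∈ Icc t₁ t₂, ∀ j k : ℤ, j ≠ 0 → k ≠ 0 → j ≠ k →
        ((ε j)⁻¹ * logPlus (classicalLocationZ j) ^ 2 ≤ |(k : ℝ) - j| →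
          renormHamiltonianZ t j k ≤
            C * logPlus (|(j : ℝ)| + |(k : ℝ)|) ^ 4 / ((k : ℝ) - j) ^ 2) ∧
        (ε j * logPlus (classicalLocationZ j) ^ 2 ≤ |(k : ℝ) - j| →
          |(k : ℝ) - j| ≤ (ε j)⁻¹ * logPlus (classicalLocationZ j) ^ 2 →
          renormHamiltonianZ t j k ≤ C * (ε j) ^ 2 * logPlus j ^ 4 / ((k : ℝ) - j) ^ 2) ∧
        (|(k : ℝ) - j| < ε j * logPlus (classicalLocationZ j) ^ 2 →
          renormHamiltonianZ t j k ≤ C * logPlus j ^ 2 * logPlus (logPlus j)) := by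
  have hΛ : ∀ t ∈ Icc t₁ t₂, ∃ t' : ℝ, t' < t ∧ HasOnlyRealZeros (deBruijnH t') :=
    fun t ht ↦ ⟨t₀, by linarith [ht.1], hreal⟩
  have hl2 : 0 < Real.log 2 := Real.log_pos one_lt_two
  -- the constants of Lemma 8, (44), Proposition 13, (45), and the modulus of (52)
  set B' : ℝ := max B 0 with hB'
  have hB'0 : 0 ≤ B' := le_max_right _ _
  have h50' : ∀ t ∈ Icc t₁ t₂, ∀ n : ℕ, 1 ≤ n →
      |deBruijnZero t n - classicalLocation (n : ℝ)| ≤ B' * logPlus (classicalLocation (n : ℝ)) :=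
    fun t ht n hn ↦ (h50 t ht n hn).trans
      (mul_le_mul_of_nonneg_right (le_max_left _ _) (logPlus_nonneg _))
  have h50Z : ∀ t ∈ Icc t₁ t₂, ∀ j : ℤ, j ≠ 0 →
      |deBruijnZeroZ t j - classicalLocationZ j| ≤ B' * logPlus (classicalLocationZ j) :=
    fun t ht j hj ↦ location_zstar_of_nat (h50' t ht) hj
  obtain ⟨c₁, C₁, hc₁, hcC, h8⟩ := lemma8_i_order
  set C₁' : ℝ := max C₁ 1 with hC₁'
  have hC₁'1 : 1 ≤ C₁' := le_max_right _ _
  have hcC' : c₁ ≤ C₁' := hcC.trans (le_max_left _ _)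
  have h8' : ∀ y : ℝ, 1 ≤ y →
      c₁ * (y / logPlus y) ≤ classicalLocation y ∧ classicalLocation y ≤ C₁' * (y / logPlus y) :=
    fun y hy ↦ ⟨(h8 y hy).1, (h8 y hy).2.1.trans
      (mul_le_mul_of_nonneg_right (le_max_left _ _) (div_nonneg (by linarith) (logPlus_nonneg _)))⟩
  have h8L : ∀ y : ℝ, 1 ≤ y →
      c₁ * logPlus y ≤ logPlus (classicalLocation y) ∧
        logPlus (classicalLocation y) ≤ C₁' * logPlus y :=
    fun y hy ↦ ⟨(h8 y hy).2.2.1, (h8 y hy).2.2.2.trans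
      (mul_le_mul_of_nonneg_right (le_max_left _ _) (logPlus_nonneg _))⟩
  have h8Z : ∀ i : ℤ, i ≠ 0 → c₁ * logPlus (i : ℝ) ≤ logPlus (classicalLocationZ i) ∧
      logPlus (classicalLocationZ i) ≤ C₁' * logPlus (i : ℝ) :=
    fun i hi ↦ logPlus_classicalLocationZ_order h8L hi
  obtain ⟨c₂, C₂, hc₂, -, hii⟩ := RodgersTao2020.lemma31_ii_holds_record
  have hii1 : ∀ j k : ℤ, j ≠ 0 → k ≠ 0 →
      c₂ * (|(k : ℝ) - j| / logPlus (|classicalLocationZ j| + |classicalLocationZ k|)) ≤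
        |classicalLocationZ k - classicalLocationZ j| := fun j k hj hk ↦ (hii j k hj hk).1
  obtain ⟨c₃, hc₃, hii3⟩ := lemma8_ii_pos
  obtain ⟨B₀, hB₀, hξB⟩ := exists_abs_classicalLocationZ_le
  obtain ⟨A_P, hA_P⟩ := rodgers_tao_gap_bound_of (t₂ := t₂) h01 hreal h50
  set A' : ℝ := max A_P 0 with hA'
  have hA'0 : 0 ≤ A' := le_max_right _ _
  have hP : ∀ t ∈ Icc t₁ t₂, ∀ j k : ℤ, j ≠ 0 → k ≠ 0 → j ≠ k →
      hamiltonianInteraction t j k ≤ A' * (logPlus (j : ℝ) ^ 2 * logPlus (logPlus (j : ℝ))) :=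
    fun t ht j k hj hk hjk ↦ (hA_P t ht j k hj hk hjk.symm).trans
      (mul_le_mul_of_nonneg_right (le_max_left _ _) (mul_nonneg (sq_nonneg _) (logPlus_nonneg _)))
  obtain ⟨A₃, hA₃⟩ := RodgersTao2020.lemma31_iii_holds 2 (by norm_num)
  set A₃' : ℝ := max A₃ 0 with hA₃'
  have h45 : ∀ p q : ℝ, 1 ≤ p → 1 ≤ q → p ≤ 2 * q → q ≤ 2 * p →
      |classicalLocation q - classicalLocation p -
          4 * π * (q - p) / Real.log (classicalLocation p / (4 * π))| ≤
        A₃' * ((q - p) ^ 2 / (p * Real.log (classicalLocation p) ^ 2)) :=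
    fun p q hp hq hpq hqp ↦ (hA₃ p q hp hq hpq hqp).trans
      (mul_le_mul_of_nonneg_right (le_max_left _ _) (by positivity))
  set Cξ : ℝ := A₃' + 80 * π with hCξ
  have hCξ0 : 0 < Cξ := by positivity
  obtain ⟨η, hη0, hη1, hηlim, n₀, hη52⟩ := exists_gap_modulus h52
  -- ε₁, Θ, ε
  set κ : ℝ := Real.log (2 + B₀) with hκ
  set G : ℝ := 16 * B' * (κ / Real.log 2 + 2) ^ 2 / c₂ + 1 with hG
  have hG0 : 0 < G := by positivity
  set ε₁ : ℝ := min 1 (c₁ ^ 2 / G) with hε₁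
  have hε₁0 : 0 < ε₁ := lt_min one_pos (by positivity)
  have hε₁1 : ε₁ ≤ 1 := min_le_left _ _
  obtain ⟨Θ, hΘ⟩ : ∃ Θ : ℕ → ℝ, ∀ n : ℕ,
      Θ n = 48 / c₃ * (2 * η n + Cξ / logPlus (classicalLocation ((n : ℕ) : ℝ))) :=
    ⟨_, fun _ ↦ rfl⟩
  have hΘ0 : ∀ n : ℕ, 0 < Θ n := fun n ↦ by
    rw [hΘ]; have := hη0 n; have := logPlus_pos (classicalLocation ((n : ℕ) : ℝ)); positivity
  have hΘlo : ∀ n : ℕ, 48 / c₃ * (Cξ / logPlus (classicalLocation ((n : ℕ) : ℝ))) ≤ Θ n :=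
    fun n ↦ by
    rw [hΘ]; have := hη0 n
    exact mul_le_mul_of_nonneg_left (by linarith) (by positivity)
  obtain ⟨ε, hεdef⟩ : ∃ ε : ℤ → ℝ, ∀ j, ε j = min ε₁ (2 * Real.sqrt (Θ j.natAbs)) :=
    ⟨_, fun _ ↦ rfl⟩
  have hε0 : ∀ j, 0 < ε j := fun j ↦ by
    rw [hεdef]; have := Real.sqrt_pos.2 (hΘ0 j.natAbs); exact lt_min hε₁0 (by positivity)
  have hεε₁ : ∀ j, ε j ≤ ε₁ := fun j ↦ by rw [hεdef]; exact min_le_left _ _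
  have hε1 : ∀ j, ε j ≤ 1 := fun j ↦ (hεε₁ j).trans hε₁1
  have hεΘ : ∀ j, ε j ≤ 2 * Real.sqrt (Θ j.natAbs) := fun j ↦ by
    rw [hεdef]; exact min_le_right _ _
  have hεneg : ∀ j, ε (-j) = ε j := fun j ↦ by rw [hεdef, hεdef, Int.natAbs_neg]
  have hΘsmall : ∀ η₀ : ℝ, 0 < η₀ → ∃ N : ℕ, ∀ n : ℕ, N ≤ n → Θ n ≤ η₀ ^ 2 / 4 := by
    intro η₀ hη₀
    obtain ⟨N, hN⟩ := theta_eventually_le (Cξ := Cξ) hc₃ hc₁ hηlim (fun y hy ↦ (h8L y hy).1) hη₀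
    exact ⟨N, fun n hn ↦ by rw [hΘ]; exact hN n hn⟩
  refine ⟨ε, hε0, ?_, ?_⟩
  · -- `ε(j) → 0`
    intro η₀ hη₀
    obtain ⟨N, hN⟩ := hΘsmall η₀ hη₀
    refine ⟨N, fun j hj ↦ ?_⟩
    have hn : N ≤ j.natAbs := by
      have : (N : ℝ) ≤ (j.natAbs : ℝ) := by rw [natAbs_cast_eq]; exact hj
      exact_mod_cast this
    calc ε j ≤ 2 * Real.sqrt (Θ j.natAbs) := hεΘ j
      _ ≤ 2 * Real.sqrt (η₀ ^ 2 / 4) := by gcongr; exact hN _ hn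
      _ = η₀ := by
          rw [show η₀ ^ 2 / 4 = (η₀ / 2) ^ 2 by ring, Real.sqrt_sq (by positivity)]; ring
  -- thresholds
  obtain ⟨d₀, hd₀⟩ := exists_logPlus_pow_le_mul (c := c₂ / (16 * B' + 16)) (by positivity) 2
  obtain ⟨J₁, hJ₁⟩ := exists_le_logPlus (Real.sqrt d₀ / c₁ + 1)
  obtain ⟨J₂, hJ₂⟩ := exists_le_logPlus ((4 * Real.log (2 * C₁' / c₁) + 4) / c₁)
  obtain ⟨J₃, hJ₃⟩ := exists_logPlus_pow_le_mul (c := 1 / C₁' ^ 4) (by positivity) 4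
  obtain ⟨J₄, hJ₄⟩ := exists_logPlus_pow_le_mul (c := 48 * Cξ / (c₃ * C₁' ^ 5)) (by positivity) 5
  obtain ⟨JΘ, hJΘ⟩ := hΘsmall ε₁ hε₁0
  set JC : ℕ := n₀ + J₂ + 2 * J₃ + J₄ + JΘ + 1 with hJC
  have hLJC : 0 < logPlus (JC : ℝ) := logPlus_pos _
  set θlo : ℝ := 48 / c₃ * (Cξ / (C₁' * logPlus (JC : ℝ))) with hθlo
  have hθlo0 : 0 < θlo := by positivity
  set εlo : ℝ := min ε₁ (2 * Real.sqrt θlo) with hεlo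
  have hεlo0 : 0 < εlo := by
    have := Real.sqrt_pos.2 hθlo0; exact lt_min hε₁0 (by positivity)
  set R : ℝ := εlo⁻¹ * (C₁' * logPlus (JC : ℝ)) ^ 2 with hR
  have hR0 : 0 < R := by positivity
  set Jb : ℕ := JC + ⌈R⌉₊ + J₁ + d₀ + 1 with hJb
  obtain ⟨Cb, hCb0, hCb⟩ := exists_renormHamiltonianZ_le_of_bounded (t₂ := t₂) h01 hreal Jb
  -- the constant
  set Cfar : ℝ := 8 * B' ^ 2 * (κ / Real.log 2 + 2) ^ 4 / c₂ ^ 2 with hCfar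
  set Cmid : ℝ := C₁' ^ 4 / 128 with hCmid
  set Cnear : ℝ := (3 + |Real.log C₂|) / Real.log 2 ^ 3 + 2 * C₁' / Real.log 2 ^ 2 +
      2 * B' * ((κ + 2 * Real.log C₁' + 2) / Real.log 2 + 4) ^ 2 / (c₂ * Real.log 2) + A'
    with hCnear
  set Cb1 : ℝ := Cb * (d₀ : ℝ) ^ 2 / Real.log 2 ^ 4 with hCb1
  set Cb2 : ℝ := Cb * R ^ 2 / (εlo ^ 2 * Real.log 2 ^ 4) with hCb2
  have hCfar0 : 0 ≤ Cfar := by positivity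
  have hCmid0 : 0 ≤ Cmid := by positivity
  have hCnear0 : 0 ≤ Cnear := by positivity
  have hCb10 : 0 ≤ Cb1 := by positivity
  have hCb20 : 0 ≤ Cb2 := by positivity
  refine ⟨Cfar + Cmid + Cnear + Cb1 + Cb2, fun t ht j k hj hk hjk ↦ ?_⟩
  have h50t := h50Z t ht
  have hΛt := hΛ t ht
  -- regime C for positive `j` (then for negative `j` by symmetry)
  have midPos : ∀ j k : ℤ, 0 < j → k ≠ 0 → j ≠ k → JC ≤ j.natAbs →
      ε j * logPlus (classicalLocationZ j) ^ 2 ≤ |(k : ℝ) - j| →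
      |(k : ℝ) - j| ≤ (ε j)⁻¹ * logPlus (classicalLocationZ j) ^ 2 →
      renormHamiltonianZ t j k ≤ Cmid * (ε j ^ 2 * logPlus (j : ℝ) ^ 4 / ((k : ℝ) - j) ^ 2) := by
    intro j k hj hk hjk hJ h2a h2b
    obtain ⟨n, rfl⟩ := Int.eq_ofNat_of_zero_le hj.le
    have hn1 : 1 ≤ n := by exact_mod_cast hj
    have hn0 : n ≠ 0 := by omega
    rw [Int.natAbs_natCast] at hJ
    rw [classicalLocationZ_natCast hn0] at h2a h2b
    simp only [Int.cast_natCast] at h2a h2b ⊢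
    set ℓn : ℝ := logPlus (classicalLocation (n : ℝ)) with hℓn
    have hn₀ : n₀ ≤ n := by omega
    have hJ₂n : J₂ ≤ n := by omega
    have hJΘn : JΘ ≤ n := by omega
    have hJ₄n : J₄ ≤ n := by omega
    have hnR1 : (1 : ℝ) ≤ n := by exact_mod_cast hn1
    obtain ⟨h8lo, h8hi⟩ := h8L (n : ℝ) hnR1
    have hℓn1 : 1 ≤ ℓn := one_le_logPlus_classicalLocation hnR1
    -- `ε(n) = 2√Θ(n)` and `Θ(n) = ε(n)²/4`
    have hΘn : Θ n ≤ ε₁ ^ 2 / 4 := hJΘ n hJΘn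
    have hεn : ε (n : ℤ) = 2 * Real.sqrt (Θ n) := by
      rw [hεdef, Int.natAbs_natCast]
      apply min_eq_right
      calc 2 * Real.sqrt (Θ n) ≤ 2 * Real.sqrt (ε₁ ^ 2 / 4) := by gcongr
        _ = ε₁ := by
            rw [show ε₁ ^ 2 / 4 = (ε₁ / 2) ^ 2 by ring, Real.sqrt_sq (by positivity)]; ring
    have hεsq : ε (n : ℤ) ^ 2 / 4 = Θ n := by
      rw [hεn, mul_pow, Real.sq_sqrt (hΘ0 n).le]; ring
    have hΘhyp : 48 / c₃ * (2 * η n + (A₃' + 80 * π) / ℓn) ≤ ε (n : ℤ) ^ 2 / 4 := by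
      rw [hεsq, hΘ]
    have hℓbig : 4 * Real.log (2 * C₁' / c₁) + 4 ≤ ℓn := by
      have h1 := hJ₂ n hJ₂n
      rw [div_le_iff₀' hc₁] at h1
      linarith
    have h4 : ∀ a : ℕ, n ≤ 2 * a → logPlus (classicalLocation (a : ℝ)) ^ 4 ≤ a := by
      intro a ha
      have haJ : J₃ ≤ a := by omega
      have ha1 : (1 : ℝ) ≤ a := by exact_mod_cast (show 1 ≤ a by omega)
      have h1 := hJ₃ a haJ
      have h2 := (h8L (a : ℝ) ha1).2
      calc logPlus (classicalLocation (a : ℝ)) ^ 4 ≤ (C₁' * logPlus (a : ℝ)) ^ 4 :=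
            pow_le_pow_left₀ (logPlus_nonneg _) h2 4
        _ = C₁' ^ 4 * logPlus (a : ℝ) ^ 4 := mul_pow _ _ _
        _ ≤ C₁' ^ 4 * (1 / C₁' ^ 4 * a) := mul_le_mul_of_nonneg_left h1 (by positivity)
        _ = a := by field_simp
    have hdj : (ε (n : ℤ))⁻¹ * ℓn ^ 2 ≤ (n : ℝ) / 2 := by
      rw [inv_mul_le_iff₀ (hε0 _), hεn]
      have h5 := hJ₄ n hJ₄n
      have h6 : ℓn ^ 5 ≤ 48 * Cξ / c₃ * n := by
        calc ℓn ^ 5 ≤ (C₁' * logPlus (n : ℝ)) ^ 5 := pow_le_pow_left₀ (logPlus_nonneg _) h8hi 5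
          _ = C₁' ^ 5 * logPlus (n : ℝ) ^ 5 := mul_pow _ _ _
          _ ≤ C₁' ^ 5 * (48 * Cξ / (c₃ * C₁' ^ 5) * n) :=
              mul_le_mul_of_nonneg_left h5 (by positivity)
          _ = 48 * Cξ / c₃ * n := by field_simp
      have h7 : ℓn ^ 4 ≤ (n : ℝ) ^ 2 * Θ n := by
        have h7a : ℓn ^ 4 ≤ 48 * Cξ / c₃ * n / ℓn := by
          rw [le_div_iff₀ (by linarith)]
          calc ℓn ^ 4 * ℓn = ℓn ^ 5 := by ring
            _ ≤ _ := h6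
        have h7b : 48 * Cξ / c₃ * n / ℓn ≤ (n : ℝ) ^ 2 * (48 / c₃ * (Cξ / ℓn)) := by
          have e : 48 * Cξ / c₃ * n / ℓn = (n : ℝ) * (48 / c₃ * (Cξ / ℓn)) := by
            field_simp
          rw [e]
          apply mul_le_mul_of_nonneg_right _ (by positivity)
          calc (n : ℝ) = n * 1 := by ring
            _ ≤ n * n := mul_le_mul_of_nonneg_left hnR1 (by positivity)
            _ = (n : ℝ) ^ 2 := by ring
        exact h7a.trans (h7b.trans (mul_le_mul_of_nonneg_left (hΘlo n) (by positivity)))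
      have h9 : ℓn ^ 2 ≤ (n : ℝ) * Real.sqrt (Θ n) := by
        have hs : Real.sqrt ((n : ℝ) ^ 2 * Θ n) = (n : ℝ) * Real.sqrt (Θ n) := by
          rw [Real.sqrt_mul (by positivity), Real.sqrt_sq (by positivity)]
        have e : (ℓn ^ 2) ^ 2 = ℓn ^ 4 := by ring
        have := Real.sqrt_le_sqrt (show (ℓn ^ 2) ^ 2 ≤ (n : ℝ) ^ 2 * Θ n by rw [e]; exact h7)
        rwa [Real.sqrt_sq (sq_nonneg _), hs] at this
      calc ℓn ^ 2 ≤ (n : ℝ) * Real.sqrt (Θ n) := h9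
        _ = 2 * Real.sqrt (Θ n) * ((n : ℝ) / 2) := by ring
    -- `k > 0`
    have hkpos : 0 < k := by
      by_contra hcon
      have hk0 : (k : ℝ) ≤ 0 := by exact_mod_cast (show k ≤ 0 by omega)
      have h1 : (n : ℝ) ≤ |(k : ℝ) - n| := by
        rw [abs_sub_comm, abs_of_nonneg (by linarith)]; linarith
      linarith
    obtain ⟨m, rfl⟩ := Int.eq_ofNat_of_zero_le hkpos.le
    have hm1 : 1 ≤ m := by exact_mod_cast hkpos
    simp only [Int.cast_natCast] at h2a h2b ⊢
    have hnm : n ≠ m := fun h ↦ hjk (by rw [h])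
    have hH := renormHamiltonianZ_le_middle_clause (t := t) (hη0 n).le hCξ0.le h45
      (hη52 n hn₀ t ht) hc₃ hii3 hc₁ hcC' h8' h4 (hε0 _) (hε1 _) hΘhyp hℓbig hdj hn1 hm1 hnm
      h2a h2b
    have hd2 : (0 : ℝ) < ((m : ℝ) - n) ^ 2 := by
      have : (m : ℝ) - n ≠ 0 := sub_ne_zero.2 (by exact_mod_cast hnm.symm)
      positivity
    calc renormHamiltonianZ t n m ≤ ε (n : ℤ) ^ 2 * ℓn ^ 4 / (128 * ((m : ℝ) - n) ^ 2) := hH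
      _ ≤ ε (n : ℤ) ^ 2 * (C₁' * logPlus (n : ℝ)) ^ 4 / (128 * ((m : ℝ) - n) ^ 2) :=
          div_le_div_of_nonneg_right (mul_le_mul_of_nonneg_left
            (pow_le_pow_left₀ (logPlus_nonneg _) h8hi 4) (sq_nonneg _)) (by positivity)
      _ = Cmid * (ε (n : ℤ) ^ 2 * logPlus (n : ℝ) ^ 4 / ((m : ℝ) - n) ^ 2) := by
          rw [hCmid]
          field_simp
  have midZ : JC ≤ j.natAbs →
      ε j * logPlus (classicalLocationZ j) ^ 2 ≤ |(k : ℝ) - j| →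
      |(k : ℝ) - j| ≤ (ε j)⁻¹ * logPlus (classicalLocationZ j) ^ 2 →
      renormHamiltonianZ t j k ≤ Cmid * (ε j ^ 2 * logPlus (j : ℝ) ^ 4 / ((k : ℝ) - j) ^ 2) := by
    intro hJ h2a h2b
    rcases lt_or_gt_of_ne hj with hneg | hpos
    · have hJ' : JC ≤ (-j).natAbs := by rwa [Int.natAbs_neg]
      have e1 : |((-k : ℤ) : ℝ) - ((-j : ℤ) : ℝ)| = |(k : ℝ) - j| := by
        push_cast; rw [show -(k : ℝ) - -(j : ℝ) = -((k : ℝ) - j) by ring, abs_neg]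
      have e2 : logPlus (classicalLocationZ (-j)) = logPlus (classicalLocationZ j) := by
        rw [classicalLocationZ_neg, logPlus_neg]
      have h := midPos (-j) (-k) (by omega) (by omega) (fun h ↦ hjk (neg_inj.1 h)) hJ'
        (by rw [hεneg, e2, e1]; exact h2a) (by rw [hεneg, e2, e1]; exact h2b)
      have e3 : logPlus (((-j : ℤ) : ℝ)) = logPlus (j : ℝ) := by push_cast; exact logPlus_neg _
      have e4 : (((-k : ℤ) : ℝ) - ((-j : ℤ) : ℝ)) ^ 2 = ((k : ℝ) - j) ^ 2 := by push_cast; ring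
      rw [renormHamiltonianZ_neg_neg, hεneg, e3, e4] at h
      exact h
    · exact midPos j k hpos hk hjk hJ h2a h2b
  -- per-pair facts
  have hd1R : (1 : ℝ) ≤ |(k : ℝ) - j| := by
    rw [← Int.cast_sub, ← Int.cast_abs]
    exact_mod_cast Int.one_le_abs (sub_ne_zero.2 hjk.symm)
  have hdpos : (0 : ℝ) < |(k : ℝ) - j| := by linarith
  have hd2pos : (0 : ℝ) < ((k : ℝ) - j) ^ 2 := by rw [← sq_abs]; positivity
  set ℓ : ℝ := logPlus (classicalLocationZ j) with hℓ
  obtain ⟨hℓlo, hℓhi⟩ := h8Z j hj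
  have hLj : Real.log 2 ≤ logPlus (j : ℝ) := log_two_le_logPlus _
  have hε0j := hε0 j
  set n : ℕ := j.natAbs with hn
  have hnR : (n : ℝ) = |(j : ℝ)| := natAbs_cast_eq j
  have hLn : logPlus (n : ℝ) = logPlus (j : ℝ) := by rw [hnR, logPlus_abs]
  have hℓn_eq : logPlus (classicalLocation (n : ℝ)) = ℓ := logPlus_classicalLocation_natAbs hj
  have hD : (((k - j).natAbs : ℕ) : ℝ) = |(k : ℝ) - j| := by rw [natAbs_cast_eq, Int.cast_sub]
  have hbdd : n ≤ Jb → n + (k - j).natAbs ≤ Jb → renormHamiltonianZ t j k ≤ Cb := by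
    intro hnJ hsum
    refine hCb t ht j k hj hk hjk ?_ ?_
    · rw [← Int.natCast_natAbs]; exact_mod_cast hnJ
    · rw [← Int.natCast_natAbs]
      have h1 : k.natAbs ≤ n + (k - j).natAbs := by
        have h := Int.natAbs_add_le j (k - j)
        rwa [show j + (k - j) = k by ring] at h
      exact_mod_cast h1.trans hsum
  refine ⟨fun h1 ↦ ?_, fun h2a h2b ↦ ?_, fun h3 ↦ ?_⟩
  · ---- clause (1): far field, or a bounded pair
    have hq0 : 0 ≤ logPlus (|(j : ℝ)| + |(k : ℝ)|) ^ 4 / ((k : ℝ) - j) ^ 2 := by positivity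
    have hfar1 : 16 * B' * (κ / Real.log 2 + 2) ^ 2 / c₂ * logPlus (j : ℝ) ^ 2 ≤ |(k : ℝ) - j| := by
      have h1a : G / c₁ ^ 2 ≤ (ε j)⁻¹ := by
        have h : ε j ≤ c₁ ^ 2 / G := (hεε₁ j).trans (min_le_right _ _)
        calc G / c₁ ^ 2 = (c₁ ^ 2 / G)⁻¹ := by rw [inv_div]
          _ ≤ (ε j)⁻¹ := inv_anti₀ hε0j h
      have h1b : c₁ ^ 2 * logPlus (j : ℝ) ^ 2 ≤ ℓ ^ 2 := by
        rw [← mul_pow]; exact pow_le_pow_left₀ (mul_nonneg hc₁.le (logPlus_nonneg _)) hℓlo 2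
      have h1c : G * logPlus (j : ℝ) ^ 2 ≤ (ε j)⁻¹ * ℓ ^ 2 := by
        calc G * logPlus (j : ℝ) ^ 2 = G / c₁ ^ 2 * (c₁ ^ 2 * logPlus (j : ℝ) ^ 2) := by
              field_simp
          _ ≤ (ε j)⁻¹ * ℓ ^ 2 := mul_le_mul h1a h1b (by positivity) (by positivity)
      have h1d : 16 * B' * (κ / Real.log 2 + 2) ^ 2 / c₂ * logPlus (j : ℝ) ^ 2 ≤
          G * logPlus (j : ℝ) ^ 2 :=
        mul_le_mul_of_nonneg_right (by rw [hG]; linarith) (sq_nonneg _)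
      linarith
    rcases le_or_gt (d₀ : ℝ) |(k : ℝ) - j| with hfar | hnear
    · have hfar2 : 16 * B' * logPlus ((k : ℝ) - j) ^ 2 / c₂ ≤ |(k : ℝ) - j| := by
        have hDn : d₀ ≤ (k - j).natAbs := by
          have : (d₀ : ℝ) ≤ (((k - j).natAbs : ℕ) : ℝ) := by rw [hD]; exact hfar
          exact_mod_cast this
        have h2 := hd₀ _ hDn
        rw [hD, logPlus_abs] at h2
        have h3 : 16 * B' * logPlus ((k : ℝ) - j) ^ 2 / c₂ ≤
            16 * B' * (c₂ / (16 * B' + 16) * |(k : ℝ) - j|) / c₂ :=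
          div_le_div_of_nonneg_right (mul_le_mul_of_nonneg_left h2 (by positivity)) hc₂.le
        have h4 : 16 * B' * (c₂ / (16 * B' + 16) * |(k : ℝ) - j|) / c₂ =
            16 * B' / (16 * B' + 16) * |(k : ℝ) - j| := by
          field_simp
        have h5 : 16 * B' / (16 * B' + 16) ≤ 1 := by
          rw [div_le_one (by positivity)]; linarith
        have h6 := mul_le_mul_of_nonneg_right h5 hdpos.le
        linarith
      have hH := renormHamiltonianZ_le_far_clause hB'0 h50t hc₂ hii1 hB₀ hξB hj hk hjk hfar1 hfar2
      calc renormHamiltonianZ t j k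
          ≤ Cfar * (logPlus (|(j : ℝ)| + |(k : ℝ)|) ^ 4 / ((k : ℝ) - j) ^ 2) := hH
        _ ≤ (Cfar + Cmid + Cnear + Cb1 + Cb2) *
              (logPlus (|(j : ℝ)| + |(k : ℝ)|) ^ 4 / ((k : ℝ) - j) ^ 2) :=
            mul_le_mul_of_nonneg_right (by linarith) hq0
        _ = _ := by ring
    · -- bounded pair: `ℓ² < d₀` forces `|j| < J₁`, and `|k − j| < d₀`
      have hℓd : ℓ ^ 2 < d₀ := by
        have : ℓ ^ 2 ≤ (ε j)⁻¹ * ℓ ^ 2 :=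
          le_mul_of_one_le_left (sq_nonneg _) ((one_le_inv₀ hε0j).2 (hε1 j))
        linarith
      have hnJ₁ : n < J₁ := by
        by_contra hcon
        have h1 := hJ₁ n (by omega)
        rw [hLn, div_add_one hc₁.ne', div_le_iff₀' hc₁] at h1
        have h2 : Real.sqrt d₀ + c₁ ≤ ℓ := by linarith
        have h3 : (d₀ : ℝ) ≤ ℓ ^ 2 := by
          have h3' : Real.sqrt d₀ ≤ ℓ := by linarith
          have h3'' := pow_le_pow_left₀ (Real.sqrt_nonneg _) h3' 2
          rwa [Real.sq_sqrt (Nat.cast_nonneg d₀)] at h3''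
        linarith
      have hdn : (k - j).natAbs < d₀ := by
        have : (((k - j).natAbs : ℕ) : ℝ) < d₀ := by rw [hD]; exact hnear
        exact_mod_cast this
      have hH : renormHamiltonianZ t j k ≤ Cb := hbdd (by omega) (by omega)
      have hL4 : Real.log 2 ^ 4 ≤ logPlus (|(j : ℝ)| + |(k : ℝ)|) ^ 4 :=
        pow_le_pow_left₀ hl2.le (log_two_le_logPlus _) 4
      have hdd : ((k : ℝ) - j) ^ 2 ≤ (d₀ : ℝ) ^ 2 := by
        rw [← sq_abs]; exact pow_le_pow_left₀ hdpos.le hnear.le 2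
      have hd₀pos : (0 : ℝ) < d₀ := by linarith
      have key : Cb ≤ Cb1 * (logPlus (|(j : ℝ)| + |(k : ℝ)|) ^ 4 / ((k : ℝ) - j) ^ 2) := by
        have e : Cb = Cb1 * (Real.log 2 ^ 4 / (d₀ : ℝ) ^ 2) := by
          rw [hCb1]
          field_simp
        rw [e]
        apply mul_le_mul_of_nonneg_left _ hCb10
        calc Real.log 2 ^ 4 / (d₀ : ℝ) ^ 2 ≤ Real.log 2 ^ 4 / ((k : ℝ) - j) ^ 2 :=
              div_le_div_of_nonneg_left (by positivity) hd2pos hdd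
          _ ≤ _ := div_le_div_of_nonneg_right hL4 hd2pos.le
      calc renormHamiltonianZ t j k ≤ Cb := hH
        _ ≤ Cb1 * (logPlus (|(j : ℝ)| + |(k : ℝ)|) ^ 4 / ((k : ℝ) - j) ^ 2) := key
        _ ≤ (Cfar + Cmid + Cnear + Cb1 + Cb2) *
              (logPlus (|(j : ℝ)| + |(k : ℝ)|) ^ 4 / ((k : ℝ) - j) ^ 2) :=
            mul_le_mul_of_nonneg_right (by linarith) hq0
        _ = _ := by ring
  · ---- clause (2): middle field for `|j| ≥ J_C`, a bounded pair otherwise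
    have hq0 : 0 ≤ ε j ^ 2 * logPlus (j : ℝ) ^ 4 / ((k : ℝ) - j) ^ 2 := by positivity
    rcases le_or_gt JC n with hbig | hsmall
    · have hH := midZ hbig h2a h2b
      calc renormHamiltonianZ t j k
          ≤ Cmid * (ε j ^ 2 * logPlus (j : ℝ) ^ 4 / ((k : ℝ) - j) ^ 2) := hH
        _ ≤ (Cfar + Cmid + Cnear + Cb1 + Cb2) *
              (ε j ^ 2 * logPlus (j : ℝ) ^ 4 / ((k : ℝ) - j) ^ 2) :=
            mul_le_mul_of_nonneg_right (by linarith) hq0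
        _ = _ := by ring
    · have hLnJ : logPlus (j : ℝ) ≤ logPlus (JC : ℝ) := by
        rw [← hLn]
        exact logPlus_mono (by
          rw [abs_of_nonneg (Nat.cast_nonneg n), abs_of_nonneg (Nat.cast_nonneg JC)]
          exact_mod_cast hsmall.le)
      have hℓJ : ℓ ≤ C₁' * logPlus (JC : ℝ) :=
        hℓhi.trans (mul_le_mul_of_nonneg_left hLnJ (by positivity))
      have hℓ1 : 1 ≤ ℓ := one_le_logPlus_classicalLocationZ hj
      have hθ : θlo ≤ Θ n := by
        calc θlo = 48 / c₃ * (Cξ / (C₁' * logPlus (JC : ℝ))) := rfl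
          _ ≤ 48 / c₃ * (Cξ / ℓ) :=
              mul_le_mul_of_nonneg_left (div_le_div_of_nonneg_left hCξ0.le (by linarith) hℓJ)
                (by positivity)
          _ = 48 / c₃ * (Cξ / logPlus (classicalLocation (n : ℝ))) := by rw [hℓn_eq]
          _ ≤ Θ n := hΘlo n
      have hεlo_le : εlo ≤ ε j := by
        rw [hεdef]
        exact min_le_min le_rfl
          (mul_le_mul_of_nonneg_left (Real.sqrt_le_sqrt hθ) (by norm_num))
      have hdR : |(k : ℝ) - j| ≤ R := by
        calc |(k : ℝ) - j| ≤ (ε j)⁻¹ * ℓ ^ 2 := h2b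
          _ ≤ εlo⁻¹ * (C₁' * logPlus (JC : ℝ)) ^ 2 :=
              mul_le_mul (inv_anti₀ hεlo0 hεlo_le) (pow_le_pow_left₀ (by linarith) hℓJ 2)
                (sq_nonneg _) (by positivity)
      have hdn : (k - j).natAbs ≤ ⌈R⌉₊ := by
        have : (((k - j).natAbs : ℕ) : ℝ) ≤ (⌈R⌉₊ : ℝ) := by
          rw [hD]; exact hdR.trans (Nat.le_ceil R)
        exact_mod_cast this
      have hH : renormHamiltonianZ t j k ≤ Cb := hbdd (by omega) (by omega)
      have hq : εlo ^ 2 * Real.log 2 ^ 4 / R ^ 2 ≤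
          ε j ^ 2 * logPlus (j : ℝ) ^ 4 / ((k : ℝ) - j) ^ 2 := by
        have hnum : εlo ^ 2 * Real.log 2 ^ 4 ≤ ε j ^ 2 * logPlus (j : ℝ) ^ 4 :=
          mul_le_mul (pow_le_pow_left₀ hεlo0.le hεlo_le 2) (pow_le_pow_left₀ hl2.le hLj 4)
            (by positivity) (by positivity)
        have hden : ((k : ℝ) - j) ^ 2 ≤ R ^ 2 := by
          rw [← sq_abs]; exact pow_le_pow_left₀ hdpos.le hdR 2
        calc εlo ^ 2 * Real.log 2 ^ 4 / R ^ 2 ≤ εlo ^ 2 * Real.log 2 ^ 4 / ((k : ℝ) - j) ^ 2 :=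
              div_le_div_of_nonneg_left (by positivity) hd2pos hden
          _ ≤ _ := div_le_div_of_nonneg_right hnum hd2pos.le
      have key : Cb ≤ Cb2 * (ε j ^ 2 * logPlus (j : ℝ) ^ 4 / ((k : ℝ) - j) ^ 2) := by
        have e : Cb = Cb2 * (εlo ^ 2 * Real.log 2 ^ 4 / R ^ 2) := by
          rw [hCb2]
          field_simp
        rw [e]
        exact mul_le_mul_of_nonneg_left hq hCb20
      calc renormHamiltonianZ t j k ≤ Cb := hH
        _ ≤ Cb2 * (ε j ^ 2 * logPlus (j : ℝ) ^ 4 / ((k : ℝ) - j) ^ 2) := key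
        _ ≤ (Cfar + Cmid + Cnear + Cb1 + Cb2) *
              (ε j ^ 2 * logPlus (j : ℝ) ^ 4 / ((k : ℝ) - j) ^ 2) :=
            mul_le_mul_of_nonneg_right (by linarith) hq0
        _ = _ := by ring
  · ---- clause (3): near field
    have hnear : |(k : ℝ) - j| ≤ ℓ ^ 2 := by
      have : ε j * ℓ ^ 2 ≤ 1 * ℓ ^ 2 := mul_le_mul_of_nonneg_right (hε1 j) (sq_nonneg _)
      linarith
    have hH := renormHamiltonianZ_le_near_clause hΛt hB'0 h50t hc₂ hii hB₀ hξB hC₁'1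
      (fun i hi ↦ (h8Z i hi).2) hA'0 hj hk hjk (hP t ht j k hj hk hjk) hnear
    have hq0 : 0 ≤ logPlus (j : ℝ) ^ 2 * logPlus (logPlus (j : ℝ)) :=
      mul_nonneg (sq_nonneg _) (logPlus_nonneg _)
    calc renormHamiltonianZ t j k ≤ Cnear * (logPlus (j : ℝ) ^ 2 * logPlus (logPlus (j : ℝ))) := hH
      _ ≤ (Cfar + Cmid + Cnear + Cb1 + Cb2) * (logPlus (j : ℝ) ^ 2 * logPlus (logPlus (j : ℝ))) :=
          mul_le_mul_of_nonneg_right (by linarith) hq0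
      _ = _ := by ring

/-- **Lemma 20 as printed, from Corollary 10 (50) + (52) as printed** (the reduction; no
`_holds`). On `Λ/2 ≤ t ≤ 0` for a real-rooted `t₀ = Λ < 0`, the as-printed Corollary 10 facts
`cor33_location` (50) and `cor33_gaps` (52) give `rodgers_tao_renormHamiltonian_decay` via
`rodgers_tao_renormHamiltonian_decay_of` with `[t₁, t₂] = [t₀/2, 0]` (the tree proves `Λ ≥ 0`,
so this range is empty and the named fact is also discharged EX FALSO in
`RodgersTaoHamiltonian.lean`; the present theorem records that the printed IMPLICATION is
RH-free). [cite: RodgersTaoFMP2020, Lemma 20 p. 45 and Corollary 10 p. 23] -/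
theorem rodgers_tao_renormHamiltonian_decay_of_cor33 :
    RodgersTao2020.cor33_location → RodgersTao2020.cor33_gaps →
      rodgers_tao_renormHamiltonian_decay := by
  intro hloc hgap t₀ ht₀ hreal
  obtain ⟨A, hA⟩ := hloc
  have h50 : ∀ t ∈ Icc (t₀ / 2) 0, ∀ n : ℕ, 1 ≤ n →
      |deBruijnZero t n - classicalLocation (n : ℝ)| ≤ A * logPlus (classicalLocation (n : ℝ)) :=
    fun t ht n hn ↦ hA t ⟨t₀, by linarith [ht.1], hreal⟩ ht.2 n hn
  have h52 : ∀ ε : ℝ, 0 < ε → ∃ j₀ : ℕ, ∀ t ∈ Icc (t₀ / 2) 0, ∀ j k : ℕ, j₀ ≤ j → j < k →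
      (k : ℝ) ≤ j + logPlus (classicalLocation (j : ℝ)) ^ 2 →
      |deBruijnZero t k - deBruijnZero t j -
          4 * π * ((k : ℝ) - j) / logPlus (classicalLocation (j : ℝ))| ≤
        ε * logPlus (classicalLocation (j : ℝ)) := by
    intro ε hε
    obtain ⟨j₀, hj₀⟩ := hgap ε hε
    exact ⟨j₀, fun t ht j k hj hjk hkj ↦ hj₀ t ⟨t₀, by linarith [ht.1], hreal⟩ ht.2 j k hj hjk hkj⟩
  have h01 : t₀ < t₀ / 2 := by linarith
  obtain ⟨ε, hε0, hεlim, C, hC⟩ := rodgers_tao_renormHamiltonian_decay_of h01 hreal h50 h52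
  exact ⟨ε, hε0, hεlim, C, fun t ht1 ht2 j k hj hk hjk ↦ hC t ⟨ht1, ht2⟩ j k hj hk hjk⟩

end Assembly


end Literature.NumberTheory.LFunctions

end
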